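import Mathlib
import HarnessLib
import Literature.NumberTheory.LFunctions.BourgainDecouplingMeanValueProofs
import Literature.NumberTheory.LFunctions.BourgainTheorem2Induction

/-!
# Bourgain's bilinear estimate (2.23) from the decoupling bound (2.10)/(2.22): the Taylor reduction

Topic `Literature/NumberTheory/LFunctions`. Fourth file of the cluster on the mean value
`A₆(N, δ, Δ)` (`Literature.NumberTheory.LFunctions.bourgainA6`) of J. Bourgain, *Decoupling,
exponential sums and the Riemann zeta function*, J. Amer. Math. Soc. 30 (2017), §3: after
`BourgainDecouplingMeanValue.lean` (definitions), `BourgainDecouplingMeanValueProofs.lean`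
(Corollary 3 ⟺ Theorem 2) and `BourgainTheorem2Induction.lean` (Theorem 2 ⇐ the bilinear estimate
(2.23), the [B-G] induction on scales (2.24)–(2.27)), this file PROVES the next layer of the
printed proof of Theorem 2 (pp. 8–9, eqs. (2.13)–(2.23)): **the bilinear estimate (2.23) for the
shifted blocks `I₁, I₂ ⊂ [N₀, N₀ + M]` follows from the decoupling bound (2.10) applied, as in
(2.22), to the curve `Φ(t) = (t, t², φ₃(t), φ₄(t))` built from the Taylor remainders (2.18)–(2.19).**

The printed argument: "Clearly (2.13) amounts to the number of solutions of the system
(2.14)–(2.17) … Write `(N₀+m)^{3/2}, (N₀+m)^{1/2}` in the form (2.18), (2.19) … Hence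
`Φ(t) = (t, t², φ₃(t), φ₄(t))` satisfies (2.11). From (2.14), (2.15), (2.18), (2.19), inequalities
(2.16), (2.17) may be replaced by (2.20), (2.21). The number of solutions of (2.14), (2.15), (2.20),
(2.21) may be evaluated by (2.22). According to (2.10), (2.22) and hence (2.13) are bounded by
`M^{6+ε}{1 + N₀^{3/2}/(N^{1/2}M)}{1 + N₀^{7/2}/(N^{1/2}M³)} ≪ N^{4+ε}M²` (2.23)." Here the three
"number of solutions" heuristics are replaced by exact identities between integrals:

1. **Taylor (2.18)–(2.19), exactly.** `Literature.NumberTheory.LFunctions.bourgainPhi3`,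
   `Literature.NumberTheory.LFunctions.bourgainPhi4` are DEFINED by the identities (2.18), (2.19)
   (`taylor_three_halves`, `taylor_one_half`), and `BourgainBilinear.phase_identity` rewrites the
   phase of (2.13) at `n = N₀ + m` as `c(x) + ψ(Tx, m)`, where
   `ψ(y, m) = m y₁ + m² y₂ + φ₃(m/M) y₃ + φ₄(m/M) y₄` is the phase of (2.22)
   (`Literature.NumberTheory.LFunctions.bourgainTaylorPhase`), `c(x)` does not depend on `m`, and
   `T` is an explicit upper-triangular linear map of `ℝ⁴` with diagonal `(1, 1, λ₃, λ₄)`,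
   `λ₃ = N^{1/2}M³/N₀^{3/2}`, `λ₄ = N^{1/2}M⁴/N₀^{7/2}` (the coefficients of (2.22)).
2. **Change of variables + periodicity, exactly.** `∫_{box} G(Tx) dx = (λ₃λ₄)⁻¹ ∫_{T(box)} G`
   (`setIntegral_comp_toLin'`), and since `G` is `ℤ²`-periodic in `(y₁, y₂)` while no two points
   of `T(box)` differ by a non-zero vector of `ℤ² × {0}²`, cutting `T(box)` along the integer grid and
   translating the pieces back shows `∫_{T(box)} G ≤ ∫_{[0,1]² × [-2λ₃, 2λ₃] × [-λ₄, λ₄]} G`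
   (`setIntegral_le_of_latticeDisjoint` — this is the "(2.14), (2.15) exact" step: the sheared unit
   cell in `(y₁, y₂)` carries the same integral as the straight one).
3. **Covering by translates.** `[0,1]² × [-2λ₃, 2λ₃] × [-λ₄, λ₄]` is covered by
   `⌈4λ₃/M²⌉ ⌈2λ₄/M⌉` translates of the cell `[0,1]² × [0, M²] × [0, M]` of (2.10)/(2.22)
   (`setIntegral_box_le_sum_cells`), each bounded by the hypothesis; the factors
   `(λ₃λ₄)⁻¹ (4λ₃/M² + 1)(2λ₄/M + 1) = (4/M² + 1/λ₃)(2/M + 1/λ₄)` are the printed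
   `M^{-3}{1 + N₀^{3/2}/(N^{1/2}M)}{1 + N₀^{7/2}/(N^{1/2}M³)}` up to constants, and `≤ 15 N⁴/M⁷`.

## The hypothesis `h222` (the printed (2.10) as used in (2.22), written out; the general (2.10) is `h222` of `Bourgain2017_eq222_of_eq210`)

For every `ε > 0` a constant `C = C(ε)` such that for all `M ≥ 1`, `N₀ > 100 M` (naturals), all
integer intervals `[a, b], [a', b'] ⊂ [0, M]` with `b < a'` and `M ≤ 4 (a' - b)` (the blocks
`I₁' = I₁ - N₀`, `I₂' = I₂ - N₀` of (2.17), "`∼ M`-separated"), and all translates `c, c' ∈ ℝ`,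
`∫_{[0,1]² × [c, c+M²] × [c', c'+M]} |∑_{m=a}^{b} e(ψ(y,m))|⁶ |∑_{m=a'}^{b'} e(ψ(y,m))|⁶ dy ≤ C M^{9+ε}`.
This is (2.10) — `‖∏_j |∑_{n∈I_j} a_n e(Φ(n/M)·x)|^{1/2}‖_{L¹²_#(Ω̃)} ≪ M^{1/2+ε} ‖ā‖_∞`,
`Ω̃ = [0,M] × [0,M²] × [0,M²] × [0,M]` — for the curve of (2.22) (which "satisfies (2.11)"), with
indicator coefficients, in the coordinates `y₁ = x₁/M`, `y₂ = x₂/M²` (so the average over `Ω̃`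
is `M^{-3} ∫_{[0,1]²×[0,M²]×[0,M]}`), and for translates of `Ω̃` ("If instead we consider a
translate `Ω + y` of `Ω`, the expression (2.8) needs to be modified replacing `a_n` by
`a_n e(Φ(n/N)·y)`", p. 8 — harmless for `‖ā‖_∞`). Its content is the decoupling Theorem 1 of the
paper (`d = 4`) and two Bourgain–Demeter `L⁶` decouplings ((2.1)–(2.10)); it is the research input
that remains.

4. **(2.11) for the Taylor curve, uniformly** (p. 9: "Hence `Φ(t) = (t, t², φ₃(t), φ₄(t))`
   satisfies (2.11)"): namespace `BourgainTaylorCurve` computes the five derivatives of `φ₃`, `φ₄`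
   in closed form and proves `|φ⁽ᵏ⁾| ≤ 1` (`k ≤ 5`), `|φ₃⁽³⁾| ≥ 1/10` and the Wronskian bound
   `|φ₃⁽³⁾(s)φ₄⁽⁴⁾(t) - φ₄⁽³⁾(s)φ₃⁽⁴⁾(t)| ≥ 1/10` on `[0,1]` whenever `N₀ ≥ 100M`; hence the general
   decoupling bound (2.10) for curves satisfying (2.11) (hypothesis `h222` of
   `Bourgain2017_eq222_of_eq210`, written out with quantitative data) implies its instance `h222`.

## Main results

* `Literature.NumberTheory.LFunctions.Bourgain2017_eq223_of_eq222` — PROVED: `h222` (the instance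
  of (2.10) for the Taylor curve, as used in (2.22)) ⟹ the bilinear estimate (2.23) in exactly the
  shape of the hypothesis `h223` of `Literature.NumberTheory.LFunctions.Bourgain2017_theorem2_of_eq223`.
* `Literature.NumberTheory.LFunctions.Bourgain2017_eq222_of_eq210` — PROVED: the general (2.10) for
  curves `(t, t², φ₃, φ₄)` satisfying (2.11) (`h222`) ⟹ `h222`.
* `Literature.NumberTheory.LFunctions.Bourgain2017_eq223_of_eq222`,
  `Literature.NumberTheory.LFunctions.Bourgain2017_theorem2_of_eq222`,
  `Literature.NumberTheory.LFunctions.Bourgain2017_corollary3_of_eq222` (and the `_of_eq222`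
  variants) — PROVED: the compositions with `BourgainTheorem2Induction.lean`; the last has as
  conclusion the hypothesis `hC3` of
  `Literature.NumberTheory.LFunctions.Bourgain2017_theorem4_log_of_reduction`, so that the research
  input left in `hC3` is exactly `h222` = Bourgain's (2.10) (Theorem 1 of the paper for `d = 4` and
  the Bourgain–Demeter `L⁶` decoupling (1.5), eqs. (2.1)–(2.10)).

## References

* J. Bourgain, *Decoupling, exponential sums and the Riemann zeta function*, J. Amer. Math. Soc.
  30 (2017), 205–224, doi:10.1090/jams/860, arXiv:1408.5794 — §3, eqs. (2.10), (2.13)–(2.23).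
-/

noncomputable section

open Complex MeasureTheory Finset
open scoped Real

namespace Literature.NumberTheory.LFunctions

/-! ### Bourgain's Taylor functions `φ₃`, `φ₄` ((2.18)–(2.19)) and the phase of (2.22) -/

/-- Bourgain's `φ₃` of (2.18), as a function of `t = m/M` (parameters `N₀`, `M`): the normalised
third-order Taylor remainder of `(N₀ + m)^{3/2}`, DEFINED by the identity (2.18)
`(N₀ + m)^{3/2} = N₀^{3/2} + (3/2) N₀^{1/2} m + (3/8) N₀^{-1/2} m² + M³ N₀^{-3/2} φ₃(m/M)`
(`taylor_three_halves`); "`φ₃(t) ∼ t³(1 + O(M/N₀) t + ⋯)`" (indeed `φ₃(t) = -t³/16 + O(M/N₀) t⁴`).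
[cite: BourgainJAMS2017, §3 eq. (2.18)] -/
def bourgainPhi3 (N₀ M t : ℝ) : ℝ :=
  N₀ ^ (3 / 2 : ℝ) / M ^ 3 *
    ((N₀ + M * t) ^ (3 / 2 : ℝ) - N₀ ^ (3 / 2 : ℝ) - 3 / 2 * N₀ ^ (1 / 2 : ℝ) * (M * t) -
      3 / 8 * (M * t) ^ 2 / N₀ ^ (1 / 2 : ℝ))

/-- Bourgain's `φ₄` of (2.19), as a function of `t = m/M`: DEFINED by the identity (2.19)
`(N₀ + m)^{1/2} = N₀^{1/2} + (1/2) N₀^{-1/2} m - (1/8) N₀^{-3/2} m² - M³ N₀^{-5/2} φ₃(m/M) + M⁴ N₀^{-7/2} φ₄(m/M)`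
(`taylor_one_half`); "`φ₄(t) ∼ t⁴`" (indeed `φ₄(t) = -t⁴/64 + O(M/N₀) t⁵`).
[cite: BourgainJAMS2017, §3 eq. (2.19)] -/
def bourgainPhi4 (N₀ M t : ℝ) : ℝ :=
  N₀ ^ (7 / 2 : ℝ) / M ^ 4 *
    ((N₀ + M * t) ^ (1 / 2 : ℝ) - N₀ ^ (1 / 2 : ℝ) - 1 / 2 * (M * t) / N₀ ^ (1 / 2 : ℝ) +
      1 / 8 * (M * t) ^ 2 / N₀ ^ (3 / 2 : ℝ) + M ^ 3 / N₀ ^ (5 / 2 : ℝ) * bourgainPhi3 N₀ M t)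

/-- The phase of Bourgain's (2.22) — the curve `Φ(t) = (t, t², φ₃(t), φ₄(t))` of (2.10)–(2.11) in the
coordinates of (2.22): `ψ(y, m) = m y₁ + m² y₂ + φ₃(m/M) y₃ + φ₄(m/M) y₄` for `m ∈ I' = I - N₀`
(coordinates `y = (y 0, y 1, y 2, y 3)` of `ℝ⁴`). [cite: BourgainJAMS2017, §3 eq. (2.22)] -/
def bourgainTaylorPhase (N₀ M : ℝ) (m : ℕ) (y : Fin 4 → ℝ) : ℝ :=
  m * y 0 + (m : ℝ) ^ 2 * y 1 + bourgainPhi3 N₀ M (m / M) * y 2 + bourgainPhi4 N₀ M (m / M) * y 3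

/-- **(2.18)**: `(N₀ + m)^{3/2} = N₀^{3/2} + (3/2) N₀^{1/2} m + (3/8) N₀^{-1/2} m² + M³ N₀^{-3/2} φ₃(m/M)`
(`N₀, M > 0`; an identity, by the definition of `φ₃`). [cite: BourgainJAMS2017, §3 eq. (2.18)] -/
theorem taylor_three_halves {N₀ M : ℝ} (hN₀ : 0 < N₀) (hM : 0 < M) (m : ℝ) :
    (N₀ + m) ^ (3 / 2 : ℝ) = N₀ ^ (3 / 2 : ℝ) + 3 / 2 * N₀ ^ (1 / 2 : ℝ) * m +
      3 / 8 * N₀ ^ (-(1 / 2) : ℝ) * m ^ 2 + M ^ 3 * N₀ ^ (-(3 / 2) : ℝ) * bourgainPhi3 N₀ M (m / M) := by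
  unfold bourgainPhi3
  rw [Real.rpow_neg hN₀.le, Real.rpow_neg hN₀.le, mul_div_cancel₀ m hM.ne']
  have h1 : N₀ ^ (3 / 2 : ℝ) ≠ 0 := (Real.rpow_pos_of_pos hN₀ _).ne'
  have h2 : N₀ ^ (1 / 2 : ℝ) ≠ 0 := (Real.rpow_pos_of_pos hN₀ _).ne'
  field_simp
  ring

/-- **(2.19)**: `(N₀ + m)^{1/2} = N₀^{1/2} + (1/2) N₀^{-1/2} m - (1/8) N₀^{-3/2} m² - M³ N₀^{-5/2} φ₃(m/M)
+ M⁴ N₀^{-7/2} φ₄(m/M)` (`N₀, M > 0`; an identity, by the definition of `φ₄`).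
[cite: BourgainJAMS2017, §3 eq. (2.19)] -/
theorem taylor_one_half {N₀ M : ℝ} (hN₀ : 0 < N₀) (hM : 0 < M) (m : ℝ) :
    (N₀ + m) ^ (1 / 2 : ℝ) = N₀ ^ (1 / 2 : ℝ) + 1 / 2 * N₀ ^ (-(1 / 2) : ℝ) * m -
      1 / 8 * N₀ ^ (-(3 / 2) : ℝ) * m ^ 2 - M ^ 3 * N₀ ^ (-(5 / 2) : ℝ) * bourgainPhi3 N₀ M (m / M) +
        M ^ 4 * N₀ ^ (-(7 / 2) : ℝ) * bourgainPhi4 N₀ M (m / M) := by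
  unfold bourgainPhi4
  rw [Real.rpow_neg hN₀.le, Real.rpow_neg hN₀.le, Real.rpow_neg hN₀.le, Real.rpow_neg hN₀.le,
    mul_div_cancel₀ m hM.ne']
  have h1 : N₀ ^ (3 / 2 : ℝ) ≠ 0 := (Real.rpow_pos_of_pos hN₀ _).ne'
  have h2 : N₀ ^ (1 / 2 : ℝ) ≠ 0 := (Real.rpow_pos_of_pos hN₀ _).ne'
  have h3 : N₀ ^ (5 / 2 : ℝ) ≠ 0 := (Real.rpow_pos_of_pos hN₀ _).ne'
  have h4 : N₀ ^ (7 / 2 : ℝ) ≠ 0 := (Real.rpow_pos_of_pos hN₀ _).ne'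
  field_simp
  ring

namespace BourgainBilinear

/-! ### Small analytic helpers -/

/-- Half-integer powers of `n₀ > 0` as powers of `r = n₀^{1/2}`. [folklore] -/
theorem rpow_halves {n₀ : ℝ} (h : 0 < n₀) :
    n₀ = (n₀ ^ (1 / 2 : ℝ)) ^ 2 ∧ n₀ ^ (3 / 2 : ℝ) = (n₀ ^ (1 / 2 : ℝ)) ^ 3 ∧
      n₀ ^ (5 / 2 : ℝ) = (n₀ ^ (1 / 2 : ℝ)) ^ 5 ∧ n₀ ^ (7 / 2 : ℝ) = (n₀ ^ (1 / 2 : ℝ)) ^ 7 := by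
  refine ⟨?_, ?_, ?_, ?_⟩
  · rw [← Real.rpow_natCast, ← Real.rpow_mul h.le]; norm_num
  · rw [← Real.rpow_natCast, ← Real.rpow_mul h.le]; norm_num
  · rw [← Real.rpow_natCast, ← Real.rpow_mul h.le]; norm_num
  · rw [← Real.rpow_natCast, ← Real.rpow_mul h.le]; norm_num

/-- `e(t + k) = e(t)` for `k ∈ ℤ`. [folklore] -/
theorem cexp_two_pi_add_int (t : ℝ) (k : ℤ) :
    Complex.exp (2 * ↑π * I * ↑(t + k)) = Complex.exp (2 * ↑π * I * ↑t) := by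
  push_cast
  rw [mul_add, Complex.exp_add]
  have : Complex.exp (2 * ↑π * I * (k : ℂ)) = 1 := by
    rw [show (2 * ↑π * I * (k : ℂ)) = (k : ℂ) * (2 * ↑π * I) by ring]
    exact Complex.exp_int_mul_two_pi_mul_I k
  rw [this, mul_one]

/-- `|e(t)| = 1`. [folklore] -/
theorem norm_cexp_two_pi_I (t : ℝ) : ‖Complex.exp (2 * ↑π * I * ↑t)‖ = 1 := by
  rw [show (2 * ↑π * I * ↑t : ℂ) = ↑(2 * π * t) * I by push_cast; ring]
  exact Complex.norm_exp_ofReal_mul_I _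

/-- An integer `k` with `t, t + k ∈ [0, 1)` vanishes. [folklore] -/
theorem int_eq_zero_of_mem_Ico {t : ℝ} {k : ℤ} (h1 : 0 ≤ t) (h2 : t < 1) (h3 : 0 ≤ t + k)
    (h4 : t + k < 1) : k = 0 := by
  have hk1 : (-1 : ℝ) < k := by linarith
  have hk2 : (k : ℝ) < 1 := by linarith
  have hk1' : (-1 : ℤ) < k := by exact_mod_cast hk1
  have hk2' : k < 1 := by exact_mod_cast hk2
  omega

/-- The phase of (2.22) is `ℤ²`-periodic in `(y₁, y₂)` modulo `ℤ`:
`ψ(y + (k₀, k₁, 0, 0), m) = ψ(y, m) + (m k₀ + m² k₁)`. [folklore] -/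
theorem taylorPhase_add_lattice (N₀ M : ℝ) (m : ℕ) (y : Fin 4 → ℝ) (k₀ k₁ : ℤ) :
    bourgainTaylorPhase N₀ M m (y + ![(k₀ : ℝ), k₁, 0, 0]) =
      bourgainTaylorPhase N₀ M m y + ((m * k₀ + m ^ 2 * k₁ : ℤ) : ℝ) := by
  unfold bourgainTaylorPhase
  simp
  ring

/-! ### Integration lemmas on `ℝ⁴` -/

/-- Sub-additivity of the set integral of a non-negative function over a finite union. [folklore] -/
theorem setIntegral_biUnion_le_sum {X : Type*} [MeasurableSpace X] {μ : Measure X}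
    {ι : Type*} (t : Finset ι) (s : ι → Set X) (hs : ∀ i ∈ t, MeasurableSet (s i))
    {f : X → ℝ} (hf0 : ∀ x, 0 ≤ f x) (hfi : ∀ i ∈ t, IntegrableOn f (s i) μ) :
    ∫ x in ⋃ i ∈ t, s i, f x ∂μ ≤ ∑ i ∈ t, ∫ x in s i, f x ∂μ := by
  classical
  induction t using Finset.induction_on with
  | empty => simp
  | insert a t hat ih =>
      have hs' : ∀ i ∈ t, MeasurableSet (s i) := fun i hi => hs i (mem_insert_of_mem hi)
      have hfi' : ∀ i ∈ t, IntegrableOn f (s i) μ := fun i hi => hfi i (mem_insert_of_mem hi)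
      rw [Finset.set_biUnion_insert, Finset.sum_insert hat]
      have hU : MeasurableSet (⋃ i ∈ t, s i) := Finset.measurableSet_biUnion _ hs'
      have hIU : IntegrableOn f (⋃ i ∈ t, s i) μ := integrableOn_finset_iUnion.2 hfi'
      have hIa : IntegrableOn f (s a) μ := hfi a (mem_insert_self a t)
      -- `s a ∪ U = s a ∪ (U \ s a)`, a disjoint union
      have hsplit : s a ∪ ⋃ i ∈ t, s i = s a ∪ ((⋃ i ∈ t, s i) \ s a) := by
        rw [Set.union_sdiff_self]
      rw [hsplit, setIntegral_union Set.disjoint_sdiff_right (hU.diff (hs a (mem_insert_self a t)))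
        hIa (hIU.mono_set Set.sdiff_subset)]
      have hdiff : ∫ x in (⋃ i ∈ t, s i) \ s a, f x ∂μ ≤ ∫ x in ⋃ i ∈ t, s i, f x ∂μ :=
        setIntegral_mono_set hIU (ae_of_all _ hf0) Set.sdiff_subset.eventuallyLE
      linarith [ih hs' hfi']

/-- **Shear-periodicity rearrangement** (a hand-made fundamental-domain argument; the exact form
of "(2.14), (2.15)" in the passage (2.13) → (2.22)). Let `G ≥ 0` be continuous on `ℝ⁴` and
`ℤ²`-periodic in the first two coordinates, and let `S ⊂ ℝ⁴` be a bounded measurable set no two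
points of which differ by a non-zero vector of `ℤ² × {0}²`, whose last two coordinates range in
`[u₂, v₂] × [u₃, v₃]`. Then `∫_S G ≤ ∫_{[0,1]² × [u₂,v₂] × [u₃,v₃]} G`: cut `S` along the integer
grid in `(y₀, y₁)`, translate each piece back into `[0,1)²` (neither Lebesgue measure nor `G`
changes), and observe that the translated pieces are pairwise disjoint. [folklore] -/
theorem setIntegral_le_of_latticeDisjoint {G : (Fin 4 → ℝ) → ℝ} (hGc : Continuous G)
    (hG0 : ∀ y, 0 ≤ G y) (hGper : ∀ y (k₀ k₁ : ℤ), G (y + ![(k₀ : ℝ), k₁, 0, 0]) = G y)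
    {S : Set (Fin 4 → ℝ)} (hSm : MeasurableSet S) {B : ℕ}
    (hSB : ∀ y ∈ S, |y 0| ≤ B ∧ |y 1| ≤ B) {u₂ v₂ u₃ v₃ : ℝ}
    (hS23 : ∀ y ∈ S, y 2 ∈ Set.Icc u₂ v₂ ∧ y 3 ∈ Set.Icc u₃ v₃)
    (hSfd : ∀ y ∈ S, ∀ k₀ k₁ : ℤ, y + ![(k₀ : ℝ), k₁, 0, 0] ∈ S → k₀ = 0 ∧ k₁ = 0) :
    ∫ y in S, G y ≤ ∫ y in Set.Icc ![0, 0, u₂, u₃] ![1, 1, v₂, v₃], G y := by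
  -- the grid cells
  set K : Finset (ℤ × ℤ) := (Finset.Icc (-(B : ℤ) - 1) B) ×ˢ (Finset.Icc (-(B : ℤ) - 1) B) with hK
  set cell : ℤ × ℤ → Set (Fin 4 → ℝ) := fun k => {y | ⌊y 0⌋ = k.1 ∧ ⌊y 1⌋ = k.2} with hcell
  set v : ℤ × ℤ → (Fin 4 → ℝ) := fun k => ![(k.1 : ℝ), k.2, 0, 0] with hv
  have hcellm : ∀ k, MeasurableSet (cell k) := by
    intro k
    have h0 : Measurable fun y : Fin 4 → ℝ => ⌊y 0⌋ := (measurable_pi_apply 0).floor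
    have h1 : Measurable fun y : Fin 4 → ℝ => ⌊y 1⌋ := (measurable_pi_apply 1).floor
    exact (h0 (measurableSet_singleton k.1)).inter (h1 (measurableSet_singleton k.2))
  -- `S` is covered by the cells with index in `K`
  have hcover : S = ⋃ k ∈ K, S ∩ cell k := by
    ext y
    simp only [Set.mem_iUnion, Set.mem_inter_iff, exists_and_left, exists_prop]
    constructor
    · intro hy
      refine ⟨hy, (⌊y 0⌋, ⌊y 1⌋), ?_, rfl, rfl⟩
      obtain ⟨h0, h1⟩ := hSB y hy
      rw [abs_le] at h0 h1
      simp only [hK, Finset.mem_product, Finset.mem_Icc]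
      refine ⟨⟨?_, ?_⟩, ?_, ?_⟩
      · have : (-(B : ℤ) - 1 : ℤ) = ⌊(-(B : ℝ) - 1)⌋ := by
          rw [show (-(B : ℝ) - 1) = ((-(B : ℤ) - 1 : ℤ) : ℝ) by push_cast; ring, Int.floor_intCast]
        rw [this]; exact Int.floor_le_floor (by linarith)
      · exact Int.floor_le_iff.mpr (by push_cast; linarith)
      · have : (-(B : ℤ) - 1 : ℤ) = ⌊(-(B : ℝ) - 1)⌋ := by
          rw [show (-(B : ℝ) - 1) = ((-(B : ℤ) - 1 : ℤ) : ℝ) by push_cast; ring, Int.floor_intCast]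
        rw [this]; exact Int.floor_le_floor (by linarith)
      · exact Int.floor_le_iff.mpr (by push_cast; linarith)
    · rintro ⟨hy, _⟩; exact hy
  -- `S` is bounded, hence `G` is integrable on it and on its pieces
  have hSsub : S ⊆ Set.Icc ![-(B : ℝ), -(B : ℝ), u₂, u₃] ![B, B, v₂, v₃] := by
    intro y hy
    obtain ⟨h0, h1⟩ := hSB y hy
    obtain ⟨h2, h3⟩ := hS23 y hy
    rw [abs_le] at h0 h1
    simp only [Set.mem_Icc, Pi.le_def, Fin.forall_fin_succ]
    simp
    exact ⟨⟨h0.1, h1.1, h2.1, h3.1⟩, h0.2, h1.2, h2.2, h3.2⟩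
  have hGi : ∀ s ⊆ Set.Icc ![-(B : ℝ), -(B : ℝ), u₂, u₃] ![B, B, v₂, v₃], IntegrableOn G s :=
    fun s hs => (hGc.continuousOn.integrableOn_compact isCompact_Icc).mono_set hs
  -- step 1: cut along the grid
  have hstep1 : ∫ y in S, G y = ∑ k ∈ K, ∫ y in S ∩ cell k, G y := by
    conv_lhs => rw [hcover]
    refine integral_biUnion_finset K (fun k _ => hSm.inter (hcellm k)) ?_
      (fun k _ => hGi _ (Set.inter_subset_left.trans hSsub))
    intro k _ j _ hkj
    refine Set.disjoint_left.mpr fun y hyk hyj => hkj ?_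
    exact Prod.ext (hyk.2.1.symm.trans hyj.2.1) (hyk.2.2.symm.trans hyj.2.2)
  -- step 2: translate each piece back
  set A : ℤ × ℤ → Set (Fin 4 → ℝ) := fun k => (fun y => y + v k) ⁻¹' (S ∩ cell k) with hA
  have hAm : ∀ k, MeasurableSet (A k) := fun k =>
    (measurable_add_const (v k)) (hSm.inter (hcellm k))
  have hstep2 : ∀ k, ∫ y in S ∩ cell k, G y = ∫ y in A k, G y := by
    intro k
    have hmp : MeasurePreserving (fun y : Fin 4 → ℝ => y + v k) volume volume :=
      measurePreserving_add_right volume (v k)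
    rw [← hmp.setIntegral_preimage_emb (measurableEmbedding_addRight (v k)) G (S ∩ cell k)]
    refine setIntegral_congr_fun (hAm k) fun y _ => ?_
    exact hGper y k.1 k.2
  -- step 3: the translated pieces are disjoint and lie in the unit cell
  have hAsub : ∀ k, A k ⊆ Set.Icc ![0, 0, u₂, u₃] ![1, 1, v₂, v₃] := by
    intro k y hy
    simp only [hA, Set.mem_preimage, Set.mem_inter_iff, hcell, Set.mem_setOf_eq] at hy
    obtain ⟨hyS, hf0, hf1⟩ := hy
    obtain ⟨h2, h3⟩ := hS23 _ hyS
    simp only [hv] at hf0 hf1 h2 h3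
    simp at hf0 hf1 h2 h3
    simp only [Set.mem_Icc, Pi.le_def, Fin.forall_fin_succ]
    simp
    exact ⟨⟨hf0.1, hf1.1, h2.1, h3.1⟩, hf0.2.le, hf1.2.le, h2.2, h3.2⟩
  have hAdisj : Set.Pairwise (↑K) (Function.onFun Disjoint A) := by
    intro k _ j _ hkj
    refine Set.disjoint_left.mpr fun y hyk hyj => hkj ?_
    simp only [hA, Set.mem_preimage, Set.mem_inter_iff] at hyk hyj
    have key := hSfd (y + v k) hyk.1 (j.1 - k.1) (j.2 - k.2) ?_
    · exact Prod.ext (by omega) (by omega)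
    · have : y + v k + ![((j.1 - k.1 : ℤ) : ℝ), ((j.2 - k.2 : ℤ) : ℝ), 0, 0] = y + v j := by
        ext i
        fin_cases i <;> simp [hv, Matrix.vecHead, Matrix.vecTail]
      rw [this]; exact hyj.1
  have hstep3 : ∑ k ∈ K, ∫ y in A k, G y ≤ ∫ y in Set.Icc ![0, 0, u₂, u₃] ![1, 1, v₂, v₃], G y := by
    rw [← integral_biUnion_finset K (fun k _ => hAm k) hAdisj (fun k _ =>
      ((hGc.continuousOn.integrableOn_compact isCompact_Icc).mono_set (hAsub k)))]
    exact setIntegral_mono_set (hGc.continuousOn.integrableOn_compact isCompact_Icc)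
      (ae_of_all _ hG0) (Set.iUnion₂_subset fun k _ => hAsub k).eventuallyLE
  calc ∫ y in S, G y = ∑ k ∈ K, ∫ y in S ∩ cell k, G y := hstep1
    _ = ∑ k ∈ K, ∫ y in A k, G y := Finset.sum_congr rfl fun k _ => hstep2 k
    _ ≤ _ := hstep3

/-- **Covering by translates**: `[0,1]² × [u₂, v₂] × [u₃, v₃]` is covered by the `n₂ n₃` cells
`[0,1]² × [u₂ + iL₂, u₂ + iL₂ + L₂] × [u₃ + jL₃, u₃ + jL₃ + L₃]` (`v₂ ≤ u₂ + n₂L₂`, `v₃ ≤ u₃ + n₃L₃`),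
so the integral of `G ≥ 0` is at most the sum of the cell integrals. [folklore] -/
theorem setIntegral_box_le_sum_cells {G : (Fin 4 → ℝ) → ℝ} (hGc : Continuous G)
    (hG0 : ∀ y, 0 ≤ G y) (u₂ u₃ : ℝ) {L₂ L₃ : ℝ} (hL₂ : 0 < L₂) (hL₃ : 0 < L₃) {n₂ n₃ : ℕ}
    (hn₂ : 0 < n₂) (hn₃ : 0 < n₃) {v₂ v₃ : ℝ} (hv₂ : v₂ ≤ u₂ + n₂ * L₂)
    (hv₃ : v₃ ≤ u₃ + n₃ * L₃) :
    ∫ y in Set.Icc ![0, 0, u₂, u₃] ![1, 1, v₂, v₃], G y ≤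
      ∑ i ∈ range n₂, ∑ j ∈ range n₃,
        ∫ y in Set.Icc ![0, 0, u₂ + i * L₂, u₃ + j * L₃]
          ![1, 1, u₂ + i * L₂ + L₂, u₃ + j * L₃ + L₃], G y := by
  set cellf : ℕ × ℕ → Set (Fin 4 → ℝ) := fun p =>
    Set.Icc ![0, 0, u₂ + p.1 * L₂, u₃ + p.2 * L₃] ![1, 1, u₂ + p.1 * L₂ + L₂, u₃ + p.2 * L₃ + L₃]
    with hcellf
  have hcover : Set.Icc ![0, 0, u₂, u₃] ![1, 1, v₂, v₃] ⊆ ⋃ p ∈ range n₂ ×ˢ range n₃, cellf p := by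
    intro y hy
    simp only [Set.mem_Icc, Pi.le_def, Fin.forall_fin_succ] at hy
    simp at hy
    obtain ⟨⟨h0, h1, h2, h3⟩, h0', h1', h2', h3'⟩ := hy
    -- indices
    set i := min ⌊(y 2 - u₂) / L₂⌋₊ (n₂ - 1) with hi
    set j := min ⌊(y 3 - u₃) / L₃⌋₊ (n₃ - 1) with hj
    have hi2 : i < n₂ := by omega
    have hj3 : j < n₃ := by omega
    have hr2 : 0 ≤ (y 2 - u₂) / L₂ := div_nonneg (by linarith) hL₂.le
    have hr3 : 0 ≤ (y 3 - u₃) / L₃ := div_nonneg (by linarith) hL₃.le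
    have hfl2 := Nat.floor_le hr2
    have hfl2' := Nat.lt_floor_add_one ((y 2 - u₂) / L₂)
    have hfl3 := Nat.floor_le hr3
    have hfl3' := Nat.lt_floor_add_one ((y 3 - u₃) / L₃)
    have hy2l : u₂ + i * L₂ ≤ y 2 := by
      have : (i : ℝ) ≤ (y 2 - u₂) / L₂ := le_trans (by exact_mod_cast min_le_left _ _) hfl2
      rw [le_div_iff₀ hL₂] at this; linarith
    have hy3l : u₃ + j * L₃ ≤ y 3 := by
      have : (j : ℝ) ≤ (y 3 - u₃) / L₃ := le_trans (by exact_mod_cast min_le_left _ _) hfl3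
      rw [le_div_iff₀ hL₃] at this; linarith
    have hy2u : y 2 ≤ u₂ + i * L₂ + L₂ := by
      rcases le_or_gt ⌊(y 2 - u₂) / L₂⌋₊ (n₂ - 1) with hc | hc
      · have hi' : i = ⌊(y 2 - u₂) / L₂⌋₊ := min_eq_left hc
        have : (y 2 - u₂) / L₂ < i + 1 := by rw [hi']; exact hfl2'
        rw [div_lt_iff₀ hL₂] at this; linarith
      · have hi' : i = n₂ - 1 := min_eq_right hc.le
        have : ((i : ℕ) : ℝ) + 1 = n₂ := by
          rw [hi']; rw [Nat.cast_sub (by omega)]; push_cast; ring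
        have e : u₂ + (i : ℝ) * L₂ + L₂ = u₂ + ((i : ℝ) + 1) * L₂ := by ring
        rw [e, this]; linarith
    have hy3u : y 3 ≤ u₃ + j * L₃ + L₃ := by
      rcases le_or_gt ⌊(y 3 - u₃) / L₃⌋₊ (n₃ - 1) with hc | hc
      · have hj' : j = ⌊(y 3 - u₃) / L₃⌋₊ := min_eq_left hc
        have : (y 3 - u₃) / L₃ < j + 1 := by rw [hj']; exact hfl3'
        rw [div_lt_iff₀ hL₃] at this; linarith
      · have hj' : j = n₃ - 1 := min_eq_right hc.le
        have : ((j : ℕ) : ℝ) + 1 = n₃ := by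
          rw [hj']; rw [Nat.cast_sub (by omega)]; push_cast; ring
        have e : u₃ + (j : ℝ) * L₃ + L₃ = u₃ + ((j : ℝ) + 1) * L₃ := by ring
        rw [e, this]; linarith
    simp only [Set.mem_iUnion, exists_prop]
    refine ⟨(i, j), by simp [hi2, hj3], ?_⟩
    simp only [hcellf, Set.mem_Icc, Pi.le_def, Fin.forall_fin_succ]
    simp
    exact ⟨⟨h0, h1, hy2l, hy3l⟩, h0', h1', hy2u, hy3u⟩
  have hGi : ∀ s : Set (Fin 4 → ℝ), (∃ a b, s = Set.Icc a b) → IntegrableOn G s := by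
    rintro s ⟨a, b, rfl⟩
    exact hGc.continuousOn.integrableOn_compact isCompact_Icc
  have hU : MeasurableSet (⋃ p ∈ range n₂ ×ˢ range n₃, cellf p) :=
    Finset.measurableSet_biUnion _ fun p _ => measurableSet_Icc
  have hIU : IntegrableOn G (⋃ p ∈ range n₂ ×ˢ range n₃, cellf p) :=
    integrableOn_finset_iUnion.2 fun p _ => hGi _ ⟨_, _, rfl⟩
  calc ∫ y in Set.Icc ![0, 0, u₂, u₃] ![1, 1, v₂, v₃], G y
      ≤ ∫ y in ⋃ p ∈ range n₂ ×ˢ range n₃, cellf p, G y :=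
        setIntegral_mono_set hIU (ae_of_all _ hG0) hcover.eventuallyLE
    _ ≤ ∑ p ∈ range n₂ ×ˢ range n₃, ∫ y in cellf p, G y :=
        setIntegral_biUnion_le_sum _ _ (fun p _ => measurableSet_Icc) hG0
          (fun p _ => hGi _ ⟨_, _, rfl⟩)
    _ = _ := by rw [Finset.sum_product]

/-- **Linear change of variables on `ℝ⁴`** for a matrix `A` with a continuous left inverse `T'`:
`∫_s G(Ax) dx = |det A|⁻¹ ∫_{T'⁻¹(s)} G` (Lebesgue measure pushes forward under `A` to
`|det A|⁻¹ ·` Lebesgue, `Real.map_linearMap_volume_pi_eq_smul_volume_pi`). [folklore] -/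
theorem setIntegral_comp_toLin' (A : Matrix (Fin 4) (Fin 4) ℝ) (hdet : A.det ≠ 0)
    (T' : (Fin 4 → ℝ) → (Fin 4 → ℝ)) (hT'c : Continuous T')
    (hinv : ∀ x, T' (Matrix.toLin' A x) = x) {G : (Fin 4 → ℝ) → ℝ} (hGc : Continuous G)
    {s : Set (Fin 4 → ℝ)} (hs : MeasurableSet s) :
    ∫ x in s, G (Matrix.toLin' A x) = |A.det|⁻¹ * ∫ y in T' ⁻¹' s, G y := by
  have hdet' : LinearMap.det (Matrix.toLin' A) ≠ 0 := by rwa [LinearMap.det_toLin']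
  have hmap := Real.map_linearMap_volume_pi_eq_smul_volume_pi hdet'
  have hfm : Measurable (Matrix.toLin' A) :=
    (LinearMap.continuous_of_finiteDimensional _).measurable
  have hpre : Matrix.toLin' A ⁻¹' (T' ⁻¹' s) = s := by
    ext x
    simp only [Set.mem_preimage]
    rw [hinv x]
  have hsm : MeasurableSet (T' ⁻¹' s) := hT'c.measurable hs
  have key := setIntegral_map (μ := volume) (s := T' ⁻¹' s) (g := Matrix.toLin' A) (f := G) hsm
    hGc.aestronglyMeasurable hfm.aemeasurable
  rw [hpre, hmap, Measure.restrict_smul, integral_smul_measure, LinearMap.det_toLin'] at key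
  rw [← key, ENNReal.toReal_ofReal (abs_nonneg _), abs_inv, smul_eq_mul]

/-! ### The upper-triangular map `T` of the reduction (2.13) → (2.22)

`T` is `y₀ = x₀ + p₁x₁ + p₂x₂ + p₃x₃`, `y₁ = x₁ + q₂x₂ + q₃x₃`, `y₂ = l₃(x₂ - c x₃)`, `y₃ = l₄x₃`; in
the application `p₁ = 2N₀`, `p₂ = (3/2)N^{1/2}N₀^{1/2}`, `p₃ = N^{1/2}/(2N₀^{1/2})`,
`q₂ = 3N^{1/2}/(8N₀^{1/2})`, `q₃ = -N^{1/2}/(8N₀^{3/2})`, `l₃ = λ₃ = N^{1/2}M³/N₀^{3/2}`, `c = 1/N₀`,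
`l₄ = λ₄ = N^{1/2}M⁴/N₀^{7/2}` (read off from (2.18)–(2.19), see `phase_identity`).
-/

/-- The map `T` in coordinates. [folklore] -/
theorem shearMatrix_toLin'_apply (p₁ p₂ p₃ q₂ q₃ l₃ l₄ c : ℝ) (x : Fin 4 → ℝ) :
    Matrix.toLin' !![1, p₁, p₂, p₃; 0, 1, q₂, q₃; 0, 0, l₃, -(l₃ * c); 0, 0, 0, l₄] x =
      ![x 0 + p₁ * x 1 + p₂ * x 2 + p₃ * x 3, x 1 + q₂ * x 2 + q₃ * x 3,
        l₃ * (x 2 - c * x 3), l₄ * x 3] := by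
  ext i
  fin_cases i
  all_goals simp [Matrix.toLin'_apply, Matrix.mulVec, dotProduct, Fin.sum_univ_four]
  all_goals try ring

/-- `det T = l₃ l₄` (upper triangular). [folklore] -/
theorem shearMatrix_det (p₁ p₂ p₃ q₂ q₃ l₃ l₄ c : ℝ) :
    Matrix.det !![1, p₁, p₂, p₃; 0, 1, q₂, q₃; 0, 0, l₃, -(l₃ * c); 0, 0, 0, l₄] = l₃ * l₄ := by
  rw [Matrix.det_of_upperTriangular]
  · simp [Fin.prod_univ_four]
  · intro i j hij
    fin_cases i <;> fin_cases j <;> simp at hij ⊢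

/-- The explicit inverse `T'` is a left inverse of `T` (`l₃, l₄ ≠ 0`). [folklore] -/
theorem shearInv_comp (p₁ p₂ p₃ q₂ q₃ l₃ l₄ c : ℝ) (hl₃ : l₃ ≠ 0) (hl₄ : l₄ ≠ 0)
    (x : Fin 4 → ℝ) :
    (fun y : Fin 4 → ℝ =>
      (![y 0 - p₁ * (y 1 - q₂ * (y 2 / l₃ + c * (y 3 / l₄)) - q₃ * (y 3 / l₄))
            - p₂ * (y 2 / l₃ + c * (y 3 / l₄)) - p₃ * (y 3 / l₄),
          y 1 - q₂ * (y 2 / l₃ + c * (y 3 / l₄)) - q₃ * (y 3 / l₄),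
          y 2 / l₃ + c * (y 3 / l₄), y 3 / l₄] : Fin 4 → ℝ))
      (Matrix.toLin' !![1, p₁, p₂, p₃; 0, 1, q₂, q₃; 0, 0, l₃, -(l₃ * c); 0, 0, 0, l₄] x) = x := by
  rw [shearMatrix_toLin'_apply]
  ext i
  fin_cases i <;> simp <;> field_simp <;> ring

/-- … and a right inverse. [folklore] -/
theorem shear_comp_shearInv (p₁ p₂ p₃ q₂ q₃ l₃ l₄ c : ℝ) (hl₃ : l₃ ≠ 0) (hl₄ : l₄ ≠ 0)
    (y : Fin 4 → ℝ) :
    Matrix.toLin' !![1, p₁, p₂, p₃; 0, 1, q₂, q₃; 0, 0, l₃, -(l₃ * c); 0, 0, 0, l₄]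
      (![y 0 - p₁ * (y 1 - q₂ * (y 2 / l₃ + c * (y 3 / l₄)) - q₃ * (y 3 / l₄))
            - p₂ * (y 2 / l₃ + c * (y 3 / l₄)) - p₃ * (y 3 / l₄),
          y 1 - q₂ * (y 2 / l₃ + c * (y 3 / l₄)) - q₃ * (y 3 / l₄),
          y 2 / l₃ + c * (y 3 / l₄), y 3 / l₄] : Fin 4 → ℝ) = y := by
  rw [shearMatrix_toLin'_apply]
  ext i
  fin_cases i <;> simp <;> field_simp <;> ring

/-- `T'` on lattice translates: `T'(y + (k₀, k₁, 0, 0)) = T' y + (k₀ - p₁ k₁, k₁, 0, 0)`. [folklore] -/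
theorem shearInv_add_lattice (p₁ p₂ p₃ q₂ q₃ l₃ l₄ c : ℝ) (y : Fin 4 → ℝ) (k₀ k₁ : ℝ) :
    (fun y : Fin 4 → ℝ =>
      (![y 0 - p₁ * (y 1 - q₂ * (y 2 / l₃ + c * (y 3 / l₄)) - q₃ * (y 3 / l₄))
            - p₂ * (y 2 / l₃ + c * (y 3 / l₄)) - p₃ * (y 3 / l₄),
          y 1 - q₂ * (y 2 / l₃ + c * (y 3 / l₄)) - q₃ * (y 3 / l₄),
          y 2 / l₃ + c * (y 3 / l₄), y 3 / l₄] : Fin 4 → ℝ)) (y + ![k₀, k₁, 0, 0]) =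
    (fun y : Fin 4 → ℝ =>
      (![y 0 - p₁ * (y 1 - q₂ * (y 2 / l₃ + c * (y 3 / l₄)) - q₃ * (y 3 / l₄))
            - p₂ * (y 2 / l₃ + c * (y 3 / l₄)) - p₃ * (y 3 / l₄),
          y 1 - q₂ * (y 2 / l₃ + c * (y 3 / l₄)) - q₃ * (y 3 / l₄),
          y 2 / l₃ + c * (y 3 / l₄), y 3 / l₄] : Fin 4 → ℝ)) y + ![k₀ - p₁ * k₁, k₁, 0, 0] := by
  ext i
  fin_cases i <;> simp <;> ring

/-- **The phase identity (2.13) → (2.22).** For `n = N₀ + m` the phase of (2.12)/(2.13),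
`φ_N(x, n) = n x₀ + n² x₁ + N^{1/2} n^{3/2} x₂ + N^{1/2} n^{1/2} x₃`, equals `c(x) + ψ(Tx, m)` with
`c(x) = N₀x₀ + N₀²x₁ + N^{1/2}N₀^{3/2}x₂ + N^{1/2}N₀^{1/2}x₃` independent of `m`, `ψ` the phase of
(2.22) and `T` the upper-triangular map above: substitute (2.18)–(2.19) and collect the terms in
`m`, `m²`, `φ₃(m/M)`, `φ₄(m/M)`. [cite: BourgainJAMS2017, §3 eqs. (2.13)–(2.23)] -/
theorem phase_identity {N N₀ M : ℕ} (hN : 1 ≤ N) (hN₀ : 1 ≤ N₀) (hM : 1 ≤ M)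
    (x : Fin 4 → ℝ) (m : ℕ) :
    bourgainA6Phase N (1 / (N : ℝ) ^ 2) (1 / N) x (N₀ + m) =
      ((N₀ : ℝ) * x 0 + (N₀ : ℝ) ^ 2 * x 1 +
          (N : ℝ) ^ (1 / 2 : ℝ) * ((N₀ : ℝ) ^ (1 / 2 : ℝ)) ^ 3 * x 2 +
          (N : ℝ) ^ (1 / 2 : ℝ) * (N₀ : ℝ) ^ (1 / 2 : ℝ) * x 3) +
        bourgainTaylorPhase N₀ M m
          (Matrix.toLin' !![1, 2 * (N₀ : ℝ), 3 / 2 * (N : ℝ) ^ (1 / 2 : ℝ) * (N₀ : ℝ) ^ (1 / 2 : ℝ),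
                (N : ℝ) ^ (1 / 2 : ℝ) / (2 * (N₀ : ℝ) ^ (1 / 2 : ℝ));
              0, 1, 3 * (N : ℝ) ^ (1 / 2 : ℝ) / (8 * (N₀ : ℝ) ^ (1 / 2 : ℝ)),
                -((N : ℝ) ^ (1 / 2 : ℝ) / (8 * ((N₀ : ℝ) ^ (1 / 2 : ℝ)) ^ 3));
              0, 0, (N : ℝ) ^ (1 / 2 : ℝ) * (M : ℝ) ^ 3 / ((N₀ : ℝ) ^ (1 / 2 : ℝ)) ^ 3,
                -((N : ℝ) ^ (1 / 2 : ℝ) * (M : ℝ) ^ 3 / ((N₀ : ℝ) ^ (1 / 2 : ℝ)) ^ 3 * (1 / (N₀ : ℝ)));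
              0, 0, 0, (N : ℝ) ^ (1 / 2 : ℝ) * (M : ℝ) ^ 4 / ((N₀ : ℝ) ^ (1 / 2 : ℝ)) ^ 7] x) := by
  have hNpos : (0 : ℝ) < N := by exact_mod_cast hN
  have hN₀pos : (0 : ℝ) < N₀ := by exact_mod_cast hN₀
  have hMpos : (0 : ℝ) < M := by exact_mod_cast hM
  rw [bourgainA6Phase_theorem2 hN, shearMatrix_toLin'_apply]
  unfold bourgainTaylorPhase
  simp only [Matrix.cons_val_zero, Matrix.cons_val_one, Matrix.cons_val]
  have h3 := taylor_three_halves hN₀pos hMpos (m : ℝ)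
  have h1 := taylor_one_half hN₀pos hMpos (m : ℝ)
  rw [Real.rpow_neg hN₀pos.le, Real.rpow_neg hN₀pos.le] at h3
  rw [Real.rpow_neg hN₀pos.le, Real.rpow_neg hN₀pos.le, Real.rpow_neg hN₀pos.le,
    Real.rpow_neg hN₀pos.le] at h1
  obtain ⟨hr2, hr3, hr5, hr7⟩ := rpow_halves hN₀pos
  set r : ℝ := (N₀ : ℝ) ^ (1 / 2 : ℝ) with hr
  set s : ℝ := (N : ℝ) ^ (1 / 2 : ℝ) with hs
  set P3 := bourgainPhi3 N₀ M (m / M) with hP3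
  set P4 := bourgainPhi4 N₀ M (m / M) with hP4
  have hrpos : 0 < r := Real.rpow_pos_of_pos hN₀pos _
  push_cast
  rw [h3, h1, hr3, hr5, hr7]
  rw [hr2]
  field_simp
  ring

end BourgainBilinear

set_option maxHeartbeats 1600000 in
open BourgainBilinear in
/-- **Bourgain 2017, the bilinear estimate (2.23) from the decoupling bound (2.10)/(2.22)**
(§3, pp. 8–9, PROVED). Hypothesis `h222` = the printed (2.10) as applied in (2.22) (see the module
docstring): for every `ε > 0` there is `C` such that for all `M ≥ 1`, `N₀ > 100M`, all integer
intervals `[a,b], [a',b'] ⊂ [0, M]` with `b < a'`, `M ≤ 4(a' - b)`, and all `c, c' ∈ ℝ`,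
`∫_{[0,1]²×[c,c+M²]×[c',c'+M]} |∑_{m=a}^{b} e(ψ(y,m))|⁶ |∑_{m=a'}^{b'} e(ψ(y,m))|⁶ dy ≤ C M^{9+ε}`
(`ψ = bourgainTaylorPhase N₀ M`). Conclusion = the printed (2.23), in exactly the shape of the
hypothesis `h223` of `Literature.NumberTheory.LFunctions.Bourgain2017_theorem2_of_eq223`: for every
`ε > 0` a `C'` (`= 15 max(C,0)`) with
`∫_{[0,1]²×[-1,1]²} |∑_{n=a}^{b} e(φ_N(x,n))|⁶ |∑_{n=a'}^{b'} e(φ_N(x,n))|⁶ dx ≤ C' N^{4+ε} M²` for all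
`N ≥ 1`, containers `[N₀, N₀+M] ⊂ [1,N]` with `100M < N₀`, and `[a,b],[a',b'] ⊂ [N₀,N₀+M]`, `b < a'`,
`M ≤ 4(a'-b)`. Proof: `phase_identity` (Taylor (2.18)–(2.19)) makes the integrand `G ∘ T` with `G`
the integrand of `h222` for the blocks `I_j' = I_j - N₀`; `setIntegral_comp_toLin'` and
`setIntegral_le_of_latticeDisjoint` turn `∫_{box} G∘T` into `≤ (λ₃λ₄)⁻¹ ∫_{[0,1]²×[-2λ₃,2λ₃]×[-λ₄,λ₄]} G`;
`setIntegral_box_le_sum_cells` and `h222` bound this by `(λ₃λ₄)⁻¹⌈4λ₃/M²⌉⌈2λ₄/M⌉ C M^{9+ε}`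
`≤ C M^{9+ε}(4/M² + 1/λ₃)(2/M + 1/λ₄) ≤ 15 C N⁴ M^{2+ε} ≤ 15 C N^{4+ε} M²`
(`1/λ₃ = N₀^{3/2}/(N^{1/2}M³) ≤ N/M³`, `1/λ₄ = N₀^{7/2}/(N^{1/2}M⁴) ≤ N³/M⁴`, `M ≤ N`) — the printed
"`M^{6+ε}{1 + N₀^{3/2}/(N^{1/2}M)}{1 + N₀^{7/2}/(N^{1/2}M³)} ≪ N^{4+ε}M²`".
[cite: BourgainJAMS2017, §3 eqs. (2.10), (2.13)–(2.23)] -/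
theorem Bourgain2017_eq223_of_eq222
    (h222 : ∀ ε : ℝ, 0 < ε → ∃ C : ℝ, ∀ N₀ M : ℕ, 1 ≤ M → 100 * M < N₀ →
      ∀ a b a' b' : ℕ, a ≤ b → b < a' → a' ≤ b' → b' ≤ M → (M : ℝ) ≤ 4 * ((a' : ℝ) - b) →
      ∀ c c' : ℝ,
        (∫ y in Set.Icc ![0, 0, c, c'] ![1, 1, c + (M : ℝ) ^ 2, c' + M],
          ‖∑ m ∈ Finset.Icc a b,
              Complex.exp (2 * ↑π * I * ↑(bourgainTaylorPhase N₀ M m y))‖ ^ 6 *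
            ‖∑ m ∈ Finset.Icc a' b',
              Complex.exp (2 * ↑π * I * ↑(bourgainTaylorPhase N₀ M m y))‖ ^ 6) ≤
          C * (M : ℝ) ^ (9 + ε)) :
    ∀ ε : ℝ, 0 < ε → ∃ C : ℝ, ∀ N : ℕ, 1 ≤ N → ∀ N₀ M : ℕ,
      100 * M < N₀ → N₀ + M ≤ N → ∀ a b a' b' : ℕ,
        N₀ ≤ a → a ≤ b → b < a' → a' ≤ b' → b' ≤ N₀ + M → (M : ℝ) ≤ 4 * ((a' : ℝ) - b) →
          (∫ x in bourgainA6Box,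
            ‖∑ n ∈ Finset.Icc a b,
                Complex.exp (2 * ↑π * I * ↑(bourgainA6Phase N (1 / (N : ℝ) ^ 2) (1 / N) x n))‖ ^ 6 *
              ‖∑ n ∈ Finset.Icc a' b',
                Complex.exp (2 * ↑π * I * ↑(bourgainA6Phase N (1 / (N : ℝ) ^ 2) (1 / N) x n))‖ ^ 6) ≤
            C * (N : ℝ) ^ (4 + ε) * (M : ℝ) ^ 2 := by
  intro ε hε
  obtain ⟨C, hC⟩ := h222 ε hε
  set C₀ := max C 0 with hC₀
  have hC₀0 : 0 ≤ C₀ := le_max_right _ _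
  refine ⟨15 * C₀, fun N hN N₀ M h100 hNM a b a' b' ha hab hba' ha'b' hb' hsep => ?_⟩
  have hM : 1 ≤ M := by omega
  have hN₀ : 1 ≤ N₀ := by omega
  -- real parameters
  have hNpos : (0 : ℝ) < N := by exact_mod_cast hN
  have hN₀pos : (0 : ℝ) < N₀ := by exact_mod_cast hN₀
  have hMpos : (0 : ℝ) < M := by exact_mod_cast hM
  have hphase := fun (x : Fin 4 → ℝ) (m : ℕ) => phase_identity hN hN₀ hM x m
  obtain ⟨hr2, hr3, hr5, hr7⟩ := rpow_halves hN₀pos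
  obtain ⟨hs2, hs3, -, hs7⟩ := rpow_halves hNpos
  set s : ℝ := (N : ℝ) ^ (1 / 2 : ℝ) with hs
  set r : ℝ := (N₀ : ℝ) ^ (1 / 2 : ℝ) with hr
  have hspos : 0 < s := Real.rpow_pos_of_pos hNpos _
  have hrpos : 0 < r := Real.rpow_pos_of_pos hN₀pos _
  -- the entries of `T`
  set p₁ : ℝ := 2 * (N₀ : ℝ) with hp₁
  set p₂ : ℝ := 3 / 2 * s * r with hp₂
  set p₃ : ℝ := s / (2 * r) with hp₃
  set q₂ : ℝ := 3 * s / (8 * r) with hq₂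
  set q₃ : ℝ := -(s / (8 * r ^ 3)) with hq₃
  set l₃ : ℝ := s * (M : ℝ) ^ 3 / r ^ 3 with hl₃
  set cc : ℝ := 1 / (N₀ : ℝ) with hcc
  set l₄ : ℝ := s * (M : ℝ) ^ 4 / r ^ 7 with hl₄
  have hl₃pos : 0 < l₃ := by positivity
  have hl₄pos : 0 < l₄ := by positivity
  have hccpos : 0 < cc := by positivity
  have hcc1 : cc ≤ 1 := by
    rw [hcc, div_le_one hN₀pos]; exact_mod_cast hN₀
  set A : Matrix (Fin 4) (Fin 4) ℝ :=
    !![1, p₁, p₂, p₃; 0, 1, q₂, q₃; 0, 0, l₃, -(l₃ * cc); 0, 0, 0, l₄] with hA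
  set T' : (Fin 4 → ℝ) → (Fin 4 → ℝ) := fun y =>
    (![y 0 - p₁ * (y 1 - q₂ * (y 2 / l₃ + cc * (y 3 / l₄)) - q₃ * (y 3 / l₄))
          - p₂ * (y 2 / l₃ + cc * (y 3 / l₄)) - p₃ * (y 3 / l₄),
        y 1 - q₂ * (y 2 / l₃ + cc * (y 3 / l₄)) - q₃ * (y 3 / l₄),
        y 2 / l₃ + cc * (y 3 / l₄), y 3 / l₄] : Fin 4 → ℝ) with hT'
  have hT'c : Continuous T' := by
    simp only [hT']
    fun_prop
  have hinv : ∀ x, T' (Matrix.toLin' A x) = x := fun x =>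
    shearInv_comp p₁ p₂ p₃ q₂ q₃ l₃ l₄ cc hl₃pos.ne' hl₄pos.ne' x
  have hinv' : ∀ y, Matrix.toLin' A (T' y) = y := fun y =>
    shear_comp_shearInv p₁ p₂ p₃ q₂ q₃ l₃ l₄ cc hl₃pos.ne' hl₄pos.ne' y
  have hT'add : ∀ (y : Fin 4 → ℝ) (k₀ k₁ : ℝ),
      T' (y + ![k₀, k₁, 0, 0]) = T' y + ![k₀ - p₁ * k₁, k₁, 0, 0] := fun y k₀ k₁ =>
    shearInv_add_lattice p₁ p₂ p₃ q₂ q₃ l₃ l₄ cc y k₀ k₁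
  have hAx : ∀ x, Matrix.toLin' A x = ![x 0 + p₁ * x 1 + p₂ * x 2 + p₃ * x 3,
      x 1 + q₂ * x 2 + q₃ * x 3, l₃ * (x 2 - cc * x 3), l₄ * x 3] := fun x =>
    shearMatrix_toLin'_apply p₁ p₂ p₃ q₂ q₃ l₃ l₄ cc x
  -- the two integrands
  set ψ : ℕ → (Fin 4 → ℝ) → ℝ := bourgainTaylorPhase N₀ M with hψ
  set G : (Fin 4 → ℝ) → ℝ := fun y =>
    ‖∑ m ∈ Finset.Icc (a - N₀) (b - N₀), Complex.exp (2 * ↑π * I * ↑(ψ m y))‖ ^ 6 *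
      ‖∑ m ∈ Finset.Icc (a' - N₀) (b' - N₀), Complex.exp (2 * ↑π * I * ↑(ψ m y))‖ ^ 6 with hG
  have hGc : Continuous G := by
    simp only [hG, hψ]
    unfold bourgainTaylorPhase bourgainPhi3 bourgainPhi4
    fun_prop
  have hG0 : ∀ y, 0 ≤ G y := fun y => by positivity
  have hGper : ∀ y (k₀ k₁ : ℤ), G (y + ![(k₀ : ℝ), k₁, 0, 0]) = G y := by
    intro y k₀ k₁
    simp only [hG, hψ]
    have h : ∀ m : ℕ, Complex.exp (2 * ↑π * I *
        ↑(bourgainTaylorPhase N₀ M m (y + ![(k₀ : ℝ), k₁, 0, 0]))) =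
        Complex.exp (2 * ↑π * I * ↑(bourgainTaylorPhase N₀ M m y)) := by
      intro m
      rw [taylorPhase_add_lattice, cexp_two_pi_add_int]
    simp_rw [h]
  -- (1) the integrand of (2.13) is `G ∘ T`
  obtain ⟨g, hg⟩ : ∃ g : ℕ → (Fin 4 → ℝ) → ℂ, ∀ n x, g n x =
      Complex.exp (2 * ↑π * I * ↑(bourgainA6Phase N (1 / (N : ℝ) ^ 2) (1 / N) x n)) :=
    ⟨_, fun _ _ => rfl⟩
  simp_rw [← hg]
  have hshift : ∀ (x : Fin 4 → ℝ) (u v : ℕ), N₀ ≤ u → u ≤ v →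
      ∑ n ∈ Finset.Icc u v, g n x =
        Complex.exp (2 * ↑π * I * ↑((N₀ : ℝ) * x 0 + (N₀ : ℝ) ^ 2 * x 1 +
          s * r ^ 3 * x 2 + s * r * x 3)) *
        ∑ m ∈ Finset.Icc (u - N₀) (v - N₀), Complex.exp (2 * ↑π * I * ↑(ψ m (Matrix.toLin' A x))) := by
    intro x u v hu huv
    have hmap : Finset.Icc u v = (Finset.Icc (u - N₀) (v - N₀)).map (addLeftEmbedding N₀) := by
      rw [Finset.map_add_left_Icc]; congr 1 <;> omega
    rw [hmap, Finset.sum_map, Finset.mul_sum]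
    refine Finset.sum_congr rfl fun m _ => ?_
    simp only [addLeftEmbedding_apply]
    rw [hg, hphase x m, ← Complex.exp_add]
    congr 1
    push_cast
    ring
  have hFG : ∀ x, ‖∑ n ∈ Finset.Icc a b, g n x‖ ^ 6 * ‖∑ n ∈ Finset.Icc a' b', g n x‖ ^ 6 =
      G (Matrix.toLin' A x) := by
    intro x
    rw [hshift x a b ha hab, hshift x a' b' (by omega) ha'b', norm_mul, norm_mul,
      norm_cexp_two_pi_I, one_mul, one_mul]
  -- (2) sharp box = half-open box a.e.
  set boxo : Set (Fin 4 → ℝ) := Set.pi Set.univ fun i => Set.Ico (![0, 0, -1, -1] i) (![1, 1, 1, 1] i)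
    with hboxo
  have hboxo_ae : boxo =ᵐ[volume] bourgainA6Box := by
    unfold bourgainA6Box
    rw [hboxo, volume_pi]
    exact Measure.univ_pi_Ico_ae_eq_Icc
  have hboxo_m : MeasurableSet boxo := MeasurableSet.univ_pi fun i => measurableSet_Ico
  have hstep2 : (∫ x in bourgainA6Box, ‖∑ n ∈ Finset.Icc a b, g n x‖ ^ 6 *
        ‖∑ n ∈ Finset.Icc a' b', g n x‖ ^ 6) = ∫ x in boxo, G (Matrix.toLin' A x) := by
    rw [setIntegral_congr_set hboxo_ae.symm]
    exact integral_congr_ae (ae_of_all _ fun x => hFG x)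
  -- (3) linear change of variables
  have hdet : A.det = l₃ * l₄ := shearMatrix_det p₁ p₂ p₃ q₂ q₃ l₃ l₄ cc
  have hdet0 : A.det ≠ 0 := by rw [hdet]; positivity
  have hstep3 : ∫ x in boxo, G (Matrix.toLin' A x) = (l₃ * l₄)⁻¹ * ∫ y in T' ⁻¹' boxo, G y := by
    rw [setIntegral_comp_toLin' A hdet0 T' hT'c hinv hGc hboxo_m, hdet,
      abs_of_pos (mul_pos hl₃pos hl₄pos)]
  -- (4) the shear-periodicity rearrangement
  set S : Set (Fin 4 → ℝ) := T' ⁻¹' boxo with hS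
  have hSm : MeasurableSet S := hT'c.measurable hboxo_m
  have hmemS : ∀ y ∈ S, (0 ≤ T' y 0 ∧ T' y 0 < 1) ∧ (0 ≤ T' y 1 ∧ T' y 1 < 1) ∧
      (-1 ≤ T' y 2 ∧ T' y 2 < 1) ∧ (-1 ≤ T' y 3 ∧ T' y 3 < 1) := by
    intro y hy
    simp only [hS, Set.mem_preimage, hboxo, Set.mem_pi, Set.mem_univ, true_implies,
      Set.mem_Ico, Fin.forall_fin_succ] at hy
    simpa using hy
  set Br : ℝ := 1 + p₁ + p₂ + p₃ + q₂ + |q₃| with hBr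
  set B : ℕ := ⌈Br⌉₊ with hB
  have hBrB : Br ≤ B := Nat.le_ceil _
  have hp₁0 : 0 ≤ p₁ := by positivity
  have hp₂0 : 0 ≤ p₂ := by positivity
  have hp₃0 : 0 ≤ p₃ := by positivity
  have hq₂0 : 0 ≤ q₂ := by positivity
  have hycoord : ∀ y ∈ S, y = ![T' y 0 + p₁ * T' y 1 + p₂ * T' y 2 + p₃ * T' y 3,
      T' y 1 + q₂ * T' y 2 + q₃ * T' y 3, l₃ * (T' y 2 - cc * T' y 3), l₄ * T' y 3] := by
    intro y _
    conv_lhs => rw [← hinv' y]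
    exact hAx (T' y)
  have hSB : ∀ y ∈ S, |y 0| ≤ B ∧ |y 1| ≤ B := by
    intro y hy
    obtain ⟨⟨h0, h0'⟩, ⟨h1, h1'⟩, ⟨h2, h2'⟩, ⟨h3, h3'⟩⟩ := hmemS y hy
    have hy := hycoord y hy
    have e0 : y 0 = T' y 0 + p₁ * T' y 1 + p₂ * T' y 2 + p₃ * T' y 3 := by
      conv_lhs => rw [hy]
      simp
    have e1 : y 1 = T' y 1 + q₂ * T' y 2 + q₃ * T' y 3 := by
      conv_lhs => rw [hy]
      simp
    have a1 : p₁ * T' y 1 ≤ p₁ := mul_le_of_le_one_right hp₁0 h1'.le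
    have a1' : 0 ≤ p₁ * T' y 1 := mul_nonneg hp₁0 h1
    have a2 : p₂ * T' y 2 ≤ p₂ := mul_le_of_le_one_right hp₂0 h2'.le
    have a2' : p₂ * (-1) ≤ p₂ * T' y 2 := mul_le_mul_of_nonneg_left h2 hp₂0
    have a3 : p₃ * T' y 3 ≤ p₃ := mul_le_of_le_one_right hp₃0 h3'.le
    have a3' : p₃ * (-1) ≤ p₃ * T' y 3 := mul_le_mul_of_nonneg_left h3 hp₃0
    have b2 : q₂ * T' y 2 ≤ q₂ := mul_le_of_le_one_right hq₂0 h2'.le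
    have b2' : q₂ * (-1) ≤ q₂ * T' y 2 := mul_le_mul_of_nonneg_left h2 hq₂0
    have b3 : |q₃ * T' y 3| ≤ |q₃| := by
      rw [abs_mul]
      exact mul_le_of_le_one_right (abs_nonneg _) (abs_le.mpr ⟨by linarith, h3'.le⟩)
    rw [abs_le] at b3
    have hq₃0 : 0 ≤ |q₃| := abs_nonneg _
    constructor
    · rw [e0, abs_le]; constructor <;> linarith
    · rw [e1, abs_le]; constructor <;> linarith
  have hS23 : ∀ y ∈ S, y 2 ∈ Set.Icc (-(2 * l₃)) (2 * l₃) ∧ y 3 ∈ Set.Icc (-l₄) l₄ := by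
    intro y hy
    obtain ⟨-, -, ⟨h2, h2'⟩, ⟨h3, h3'⟩⟩ := hmemS y hy
    have hy := hycoord y hy
    have e2 : y 2 = l₃ * (T' y 2 - cc * T' y 3) := by
      conv_lhs => rw [hy]
      simp
    have e3 : y 3 = l₄ * T' y 3 := by
      conv_lhs => rw [hy]
      simp
    have c3 : cc * T' y 3 ≤ cc := mul_le_of_le_one_right hccpos.le h3'.le
    have c3' : cc * (-1) ≤ cc * T' y 3 := mul_le_mul_of_nonneg_left h3 hccpos.le
    have d1 : l₃ * (T' y 2 - cc * T' y 3) ≤ l₃ * 2 :=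
      mul_le_mul_of_nonneg_left (by linarith) hl₃pos.le
    have d2 : l₃ * (-2) ≤ l₃ * (T' y 2 - cc * T' y 3) :=
      mul_le_mul_of_nonneg_left (by linarith) hl₃pos.le
    have d3 : l₄ * T' y 3 ≤ l₄ * 1 := mul_le_mul_of_nonneg_left h3'.le hl₄pos.le
    have d4 : l₄ * (-1) ≤ l₄ * T' y 3 := mul_le_mul_of_nonneg_left h3 hl₄pos.le
    refine ⟨⟨?_, ?_⟩, ?_, ?_⟩
    · rw [e2]; linarith
    · rw [e2]; linarith
    · rw [e3]; linarith
    · rw [e3]; linarith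
  have hSfd : ∀ y ∈ S, ∀ k₀ k₁ : ℤ, y + ![(k₀ : ℝ), k₁, 0, 0] ∈ S → k₀ = 0 ∧ k₁ = 0 := by
    intro y hy k₀ k₁ hy'
    obtain ⟨⟨h0, h0'⟩, ⟨h1, h1'⟩, -, -⟩ := hmemS y hy
    obtain ⟨⟨g0, g0'⟩, ⟨g1, g1'⟩, -, -⟩ := hmemS _ hy'
    rw [hT'add y k₀ k₁] at g0 g0' g1 g1'
    simp at g0 g0' g1 g1'
    have hk₁ : k₁ = 0 := int_eq_zero_of_mem_Ico h1 h1' g1 g1'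
    subst hk₁
    simp at g0 g0'
    have hk₀ : k₀ = 0 := int_eq_zero_of_mem_Ico h0 h0' g0 g0'
    exact ⟨hk₀, rfl⟩
  have hstep4 : ∫ y in S, G y ≤
      ∫ y in Set.Icc ![0, 0, -(2 * l₃), -l₄] ![1, 1, 2 * l₃, l₄], G y :=
    setIntegral_le_of_latticeDisjoint hGc hG0 hGper hSm hSB hS23 hSfd
  -- (5) covering by translates of `[0,1]² × [0, M²] × [0, M]`
  set n₂ : ℕ := ⌈4 * l₃ / (M : ℝ) ^ 2⌉₊ with hn₂
  set n₃ : ℕ := ⌈2 * l₄ / (M : ℝ)⌉₊ with hn₃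
  have hn₂pos : 0 < n₂ := Nat.ceil_pos.mpr (by positivity)
  have hn₃pos : 0 < n₃ := Nat.ceil_pos.mpr (by positivity)
  have hn₂le : (n₂ : ℝ) ≤ 4 * l₃ / (M : ℝ) ^ 2 + 1 := (Nat.ceil_lt_add_one (by positivity)).le
  have hn₃le : (n₃ : ℝ) ≤ 2 * l₄ / (M : ℝ) + 1 := (Nat.ceil_lt_add_one (by positivity)).le
  have hv₂ : 2 * l₃ ≤ -(2 * l₃) + n₂ * (M : ℝ) ^ 2 := by
    have h := Nat.le_ceil (4 * l₃ / (M : ℝ) ^ 2)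
    rw [← hn₂, div_le_iff₀ (by positivity)] at h
    linarith
  have hv₃ : l₄ ≤ -l₄ + n₃ * (M : ℝ) := by
    have h := Nat.le_ceil (2 * l₄ / (M : ℝ))
    rw [← hn₃, div_le_iff₀ hMpos] at h
    linarith
  have hstep5 := setIntegral_box_le_sum_cells hGc hG0 (-(2 * l₃)) (-l₄) (by positivity : (0:ℝ) < (M:ℝ)^2)
    hMpos hn₂pos hn₃pos hv₂ hv₃
  -- (6) each cell is an instance of (2.10)/(2.22)
  have hsep' : (M : ℝ) ≤ 4 * (((a' - N₀ : ℕ) : ℝ) - ((b - N₀ : ℕ) : ℝ)) := by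
    rw [Nat.cast_sub (by omega), Nat.cast_sub (by omega)]
    linarith
  have hcell : ∀ i ∈ Finset.range n₂, ∀ j ∈ Finset.range n₃,
      (∫ y in Set.Icc ![0, 0, -(2 * l₃) + i * (M : ℝ) ^ 2, -l₄ + j * (M : ℝ)]
        ![1, 1, -(2 * l₃) + i * (M : ℝ) ^ 2 + (M : ℝ) ^ 2, -l₄ + j * (M : ℝ) + M], G y) ≤
        C₀ * (M : ℝ) ^ (9 + ε) := by
    intro i _ j _
    have key := hC N₀ M hM h100 (a - N₀) (b - N₀) (a' - N₀) (b' - N₀) (by omega) (by omega)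
      (by omega) (by omega) hsep' (-(2 * l₃) + i * (M : ℝ) ^ 2) (-l₄ + j * (M : ℝ))
    refine le_trans key ?_
    gcongr
    exact le_max_left _ _
  have hstep6 : ∑ i ∈ Finset.range n₂, ∑ j ∈ Finset.range n₃,
      (∫ y in Set.Icc ![0, 0, -(2 * l₃) + i * (M : ℝ) ^ 2, -l₄ + j * (M : ℝ)]
        ![1, 1, -(2 * l₃) + i * (M : ℝ) ^ 2 + (M : ℝ) ^ 2, -l₄ + j * (M : ℝ) + M], G y) ≤
        n₂ * (n₃ * (C₀ * (M : ℝ) ^ (9 + ε))) := by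
    calc _ ≤ ∑ i ∈ Finset.range n₂, ∑ j ∈ Finset.range n₃, C₀ * (M : ℝ) ^ (9 + ε) :=
          Finset.sum_le_sum fun i hi => Finset.sum_le_sum fun j hj => hcell i hi j hj
      _ = _ := by simp
  -- (7) numerics
  have hchain : (∫ x in bourgainA6Box, ‖∑ n ∈ Finset.Icc a b, g n x‖ ^ 6 *
        ‖∑ n ∈ Finset.Icc a' b', g n x‖ ^ 6) ≤
      (l₃ * l₄)⁻¹ * (n₂ * (n₃ * (C₀ * (M : ℝ) ^ (9 + ε)))) := by
    rw [hstep2, hstep3]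
    refine mul_le_mul_of_nonneg_left ?_ (by positivity)
    exact hstep4.trans (hstep5.trans hstep6)
  refine hchain.trans ?_
  -- `(l₃ l₄)⁻¹ n₂ n₃ ≤ 15 N⁴ / M⁷`
  have hr_le_s : r ≤ s := by
    rw [hr, hs]
    exact Real.rpow_le_rpow (Nat.cast_nonneg _) (by exact_mod_cast (show N₀ ≤ N by omega)) (by norm_num)
  have hMleN : (M : ℝ) ≤ N := by exact_mod_cast (show M ≤ N by omega)
  have hM1 : (1 : ℝ) ≤ M := by exact_mod_cast hM
  have hM0 : (M : ℝ) ≠ 0 := hMpos.ne'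
  have hs0 : s ≠ 0 := hspos.ne'
  have hinv3 : l₃⁻¹ ≤ (N : ℝ) / (M : ℝ) ^ 3 := by
    have h3 : r ^ 3 ≤ s ^ 3 := by gcongr
    calc l₃⁻¹ = r ^ 3 / (s * (M : ℝ) ^ 3) := by rw [hl₃, inv_div]
      _ ≤ s ^ 3 / (s * (M : ℝ) ^ 3) := by gcongr
      _ = s ^ 2 / (M : ℝ) ^ 3 := by rw [div_eq_div_iff (by positivity) (by positivity)]; ring
      _ = (N : ℝ) / (M : ℝ) ^ 3 := by rw [hs2]
  have hinv4 : l₄⁻¹ ≤ (N : ℝ) ^ 3 / (M : ℝ) ^ 4 := by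
    have h7 : r ^ 7 ≤ s ^ 7 := by gcongr
    calc l₄⁻¹ = r ^ 7 / (s * (M : ℝ) ^ 4) := by rw [hl₄, inv_div]
      _ ≤ s ^ 7 / (s * (M : ℝ) ^ 4) := by gcongr
      _ = s ^ 6 / (M : ℝ) ^ 4 := by rw [div_eq_div_iff (by positivity) (by positivity)]; ring
      _ = (N : ℝ) ^ 3 / (M : ℝ) ^ 4 := by rw [hs2]; ring
  have hdiv2 : 1 / (M : ℝ) ^ 2 ≤ (N : ℝ) / (M : ℝ) ^ 3 := by
    rw [div_le_div_iff₀ (by positivity) (by positivity)]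
    have e : (M : ℝ) ^ 3 = M * (M : ℝ) ^ 2 := by ring
    rw [e]
    linarith [mul_le_mul_of_nonneg_right hMleN (sq_nonneg (M : ℝ))]
  have hdiv3 : 1 / (M : ℝ) ≤ (N : ℝ) ^ 3 / (M : ℝ) ^ 4 := by
    rw [div_le_div_iff₀ (by positivity) (by positivity)]
    have hM3 : (M : ℝ) ^ 3 ≤ (N : ℝ) ^ 3 := by gcongr
    have e : (M : ℝ) ^ 4 = (M : ℝ) ^ 3 * M := by ring
    rw [e]
    linarith [mul_le_mul_of_nonneg_right hM3 hMpos.le]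
  have hfac2 : l₃⁻¹ * n₂ ≤ 5 * (N : ℝ) / (M : ℝ) ^ 3 := by
    calc l₃⁻¹ * n₂ ≤ l₃⁻¹ * (4 * l₃ / (M : ℝ) ^ 2 + 1) := by gcongr
      _ = 4 * (1 / (M : ℝ) ^ 2) + l₃⁻¹ := by field_simp
      _ ≤ 4 * ((N : ℝ) / (M : ℝ) ^ 3) + (N : ℝ) / (M : ℝ) ^ 3 := by gcongr
      _ = _ := by ring
  have hfac3 : l₄⁻¹ * n₃ ≤ 3 * (N : ℝ) ^ 3 / (M : ℝ) ^ 4 := by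
    calc l₄⁻¹ * n₃ ≤ l₄⁻¹ * (2 * l₄ / (M : ℝ) + 1) := by gcongr
      _ = 2 * (1 / (M : ℝ)) + l₄⁻¹ := by field_simp
      _ ≤ 2 * ((N : ℝ) ^ 3 / (M : ℝ) ^ 4) + (N : ℝ) ^ 3 / (M : ℝ) ^ 4 := by gcongr
      _ = _ := by ring
  have hMpow : (M : ℝ) ^ (9 + ε) = (M : ℝ) ^ 7 * ((M : ℝ) ^ 2 * (M : ℝ) ^ ε) := by
    rw [show (9 + ε : ℝ) = ((7 : ℕ) : ℝ) + (((2 : ℕ) : ℝ) + ε) by push_cast; ring,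
      Real.rpow_add hMpos, Real.rpow_natCast, Real.rpow_add hMpos, Real.rpow_natCast]
  have hMε : (M : ℝ) ^ ε ≤ (N : ℝ) ^ ε := Real.rpow_le_rpow hMpos.le hMleN hε.le
  have hNpow : (N : ℝ) ^ (4 + ε) = (N : ℝ) ^ 4 * (N : ℝ) ^ ε := by
    rw [show (4 + ε : ℝ) = ((4 : ℕ) : ℝ) + ε by push_cast; ring, Real.rpow_add hNpos,
      Real.rpow_natCast]
  calc (l₃ * l₄)⁻¹ * (n₂ * (n₃ * (C₀ * (M : ℝ) ^ (9 + ε))))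
      = (l₃⁻¹ * n₂) * (l₄⁻¹ * n₃) * C₀ * (M : ℝ) ^ (9 + ε) := by rw [mul_inv]; ring
    _ ≤ (5 * (N : ℝ) / (M : ℝ) ^ 3) * (3 * (N : ℝ) ^ 3 / (M : ℝ) ^ 4) * C₀ * (M : ℝ) ^ (9 + ε) := by
        gcongr
    _ = 15 * C₀ * (N : ℝ) ^ 4 * ((M : ℝ) ^ 2 * (M : ℝ) ^ ε) := by
        rw [hMpow]; field_simp; ring
    _ ≤ 15 * C₀ * (N : ℝ) ^ 4 * ((M : ℝ) ^ 2 * (N : ℝ) ^ ε) := by gcongr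
    _ = 15 * C₀ * (N : ℝ) ^ (4 + ε) * (M : ℝ) ^ 2 := by rw [hNpow]; ring


/-! ## The Taylor curve satisfies (2.11): (2.10) ⟹ (2.22)

"`φ₃(t) ∼ t³(1 + O(M/N₀) t + ⋯)`, `φ₄(t) ∼ t⁴`. Hence `Φ(t) = (t, t², φ₃(t), φ₄(t))` satisfies (2.11)"
(p. 9). Below: the five derivatives of `φ₃`, `φ₄` in closed form, uniform bounds `|φ⁽ᵏ⁾| ≤ 1`
(`k ≤ 5`) and the lower bounds `|φ₃⁽³⁾| ≥ 1/10`, `|φ₃⁽³⁾(s)φ₄⁽⁴⁾(t) - φ₄⁽³⁾(s)φ₃⁽⁴⁾(t)| ≥ 1/10` on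
`[0,1]`, valid as soon as `N₀ ≥ 100 M` — and the resulting implication from the general decoupling
bound (2.10) (hypothesis `h210` of `Bourgain2017_eq222_of_eq210`) to its Taylor instance `h222`.
-/

namespace BourgainTaylorCurve


/-! ### Derivatives of `t ↦ (N₀ + M t)^p` -/

/-- `d/dt (N₀ + Mt)^p = M p (N₀ + Mt)^{p-1}` where the base is positive. [folklore] -/
theorem hasDerivAt_rpow_affine (N₀ M p : ℝ) {t : ℝ} (ht : 0 < N₀ + M * t) :
    HasDerivAt (fun t => (N₀ + M * t) ^ p) (M * p * (N₀ + M * t) ^ (p - 1)) t := by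
  have h1 : HasDerivAt (fun t => N₀ + M * t) (M * 1) t :=
    ((hasDerivAt_id' t).const_mul M).const_add N₀
  have h2 := h1.rpow_const (p := p) (Or.inl ht.ne')
  refine h2.congr_deriv ?_
  ring

/-! ### The derivatives of `φ₃` -/

/-- `φ₃⁽¹⁾` in closed form. [cite: BourgainJAMS2017, §3 eq. (2.18)] -/
def phi3d1 (N₀ M t : ℝ) : ℝ :=
  N₀ ^ (3 / 2 : ℝ) / M ^ 3 *
    (3 / 2 * M * (N₀ + M * t) ^ (1 / 2 : ℝ) - 3 / 2 * N₀ ^ (1 / 2 : ℝ) * M -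
      3 / 4 * M ^ 2 * t / N₀ ^ (1 / 2 : ℝ))

/-- `φ₃⁽²⁾` in closed form. [cite: BourgainJAMS2017, §3 eq. (2.18)] -/
def phi3d2 (N₀ M t : ℝ) : ℝ :=
  N₀ ^ (3 / 2 : ℝ) / M ^ 3 *
    (3 / 4 * M ^ 2 * (N₀ + M * t) ^ (-(1 / 2) : ℝ) - 3 / 4 * M ^ 2 / N₀ ^ (1 / 2 : ℝ))

/-- `φ₃⁽³⁾` in closed form: `-(3/8) N₀^{3/2} (N₀ + Mt)^{-3/2}`. [cite: BourgainJAMS2017, §3 eq. (2.18)] -/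
def phi3d3 (N₀ M t : ℝ) : ℝ :=
  N₀ ^ (3 / 2 : ℝ) / M ^ 3 * (-(3 / 8) * M ^ 3 * (N₀ + M * t) ^ (-(3 / 2) : ℝ))

/-- `φ₃⁽⁴⁾` in closed form. [cite: BourgainJAMS2017, §3 eq. (2.18)] -/
def phi3d4 (N₀ M t : ℝ) : ℝ :=
  N₀ ^ (3 / 2 : ℝ) / M ^ 3 * (9 / 16 * M ^ 4 * (N₀ + M * t) ^ (-(5 / 2) : ℝ))

/-- `φ₃⁽⁵⁾` in closed form. [cite: BourgainJAMS2017, §3 eq. (2.18)] -/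
def phi3d5 (N₀ M t : ℝ) : ℝ :=
  N₀ ^ (3 / 2 : ℝ) / M ^ 3 * (-(45 / 32) * M ^ 5 * (N₀ + M * t) ^ (-(7 / 2) : ℝ))

/-- `φ₃' = phi3d1` (where `N₀ + Mt > 0`). [folklore] -/
theorem hasDerivAt_phi3 (N₀ M : ℝ) {t : ℝ} (ht : 0 < N₀ + M * t) :
    HasDerivAt (bourgainPhi3 N₀ M) (phi3d1 N₀ M t) t := by
  have i1 : HasDerivAt (fun t => (N₀ + M * t) ^ (3 / 2 : ℝ) - N₀ ^ (3 / 2 : ℝ))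
      (M * (3 / 2) * (N₀ + M * t) ^ ((3 / 2 : ℝ) - 1)) t :=
    (hasDerivAt_rpow_affine N₀ M (3 / 2) ht).sub_const _
  have i2 : HasDerivAt (fun t : ℝ => 3 / 2 * N₀ ^ (1 / 2 : ℝ) * (M * t))
      (3 / 2 * N₀ ^ (1 / 2 : ℝ) * (M * 1)) t :=
    ((hasDerivAt_id' t).const_mul M).const_mul _
  have i3 : HasDerivAt (fun t : ℝ => 3 / 8 * (M * t) ^ 2 / N₀ ^ (1 / 2 : ℝ))
      (3 / 8 * ((2 : ℕ) * (M * t) ^ (2 - 1) * (M * 1)) / N₀ ^ (1 / 2 : ℝ)) t :=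
    ((((hasDerivAt_id' t).const_mul M).pow 2).const_mul (3 / 8)).div_const _
  have key := ((i1.sub i2).sub i3).const_mul (N₀ ^ (3 / 2 : ℝ) / M ^ 3)
  unfold bourgainPhi3 phi3d1
  refine key.congr_deriv ?_
  rw [show (3 / 2 : ℝ) - 1 = 1 / 2 by norm_num]
  push_cast
  ring

/-- `phi3d1' = phi3d2`. [folklore] -/
theorem hasDerivAt_phi3d1 (N₀ M : ℝ) {t : ℝ} (ht : 0 < N₀ + M * t) :
    HasDerivAt (phi3d1 N₀ M) (phi3d2 N₀ M t) t := by
  have i1 : HasDerivAt (fun t => 3 / 2 * M * (N₀ + M * t) ^ (1 / 2 : ℝ) - 3 / 2 * N₀ ^ (1 / 2 : ℝ) * M)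
      (3 / 2 * M * (M * (1 / 2) * (N₀ + M * t) ^ ((1 / 2 : ℝ) - 1))) t :=
    ((hasDerivAt_rpow_affine N₀ M (1 / 2) ht).const_mul _).sub_const _
  have i2 : HasDerivAt (fun t : ℝ => 3 / 4 * M ^ 2 * t / N₀ ^ (1 / 2 : ℝ))
      (3 / 4 * M ^ 2 * 1 / N₀ ^ (1 / 2 : ℝ)) t :=
    ((hasDerivAt_id' t).const_mul _).div_const _
  have key := (i1.sub i2).const_mul (N₀ ^ (3 / 2 : ℝ) / M ^ 3)
  unfold phi3d1 phi3d2
  refine key.congr_deriv ?_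
  rw [show (1 / 2 : ℝ) - 1 = -(1 / 2) by norm_num]
  ring

/-- `phi3d2' = phi3d3`. [folklore] -/
theorem hasDerivAt_phi3d2 (N₀ M : ℝ) {t : ℝ} (ht : 0 < N₀ + M * t) :
    HasDerivAt (phi3d2 N₀ M) (phi3d3 N₀ M t) t := by
  have i1 : HasDerivAt
      (fun t => 3 / 4 * M ^ 2 * (N₀ + M * t) ^ (-(1 / 2) : ℝ) - 3 / 4 * M ^ 2 / N₀ ^ (1 / 2 : ℝ))
      (3 / 4 * M ^ 2 * (M * (-(1 / 2)) * (N₀ + M * t) ^ ((-(1 / 2) : ℝ) - 1))) t :=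
    ((hasDerivAt_rpow_affine N₀ M (-(1 / 2)) ht).const_mul _).sub_const _
  have key := i1.const_mul (N₀ ^ (3 / 2 : ℝ) / M ^ 3)
  unfold phi3d2 phi3d3
  refine key.congr_deriv ?_
  rw [show (-(1 / 2) : ℝ) - 1 = -(3 / 2) by norm_num]
  ring

/-- `phi3d3' = phi3d4`. [folklore] -/
theorem hasDerivAt_phi3d3 (N₀ M : ℝ) {t : ℝ} (ht : 0 < N₀ + M * t) :
    HasDerivAt (phi3d3 N₀ M) (phi3d4 N₀ M t) t := by
  have i1 : HasDerivAt (fun t => -(3 / 8) * M ^ 3 * (N₀ + M * t) ^ (-(3 / 2) : ℝ))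
      (-(3 / 8) * M ^ 3 * (M * (-(3 / 2)) * (N₀ + M * t) ^ ((-(3 / 2) : ℝ) - 1))) t :=
    (hasDerivAt_rpow_affine N₀ M (-(3 / 2)) ht).const_mul _
  have key := i1.const_mul (N₀ ^ (3 / 2 : ℝ) / M ^ 3)
  unfold phi3d3 phi3d4
  refine key.congr_deriv ?_
  rw [show (-(3 / 2) : ℝ) - 1 = -(5 / 2) by norm_num]
  ring

/-- `phi3d4' = phi3d5`. [folklore] -/
theorem hasDerivAt_phi3d4 (N₀ M : ℝ) {t : ℝ} (ht : 0 < N₀ + M * t) :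
    HasDerivAt (phi3d4 N₀ M) (phi3d5 N₀ M t) t := by
  have i1 : HasDerivAt (fun t => 9 / 16 * M ^ 4 * (N₀ + M * t) ^ (-(5 / 2) : ℝ))
      (9 / 16 * M ^ 4 * (M * (-(5 / 2)) * (N₀ + M * t) ^ ((-(5 / 2) : ℝ) - 1))) t :=
    (hasDerivAt_rpow_affine N₀ M (-(5 / 2)) ht).const_mul _
  have key := i1.const_mul (N₀ ^ (3 / 2 : ℝ) / M ^ 3)
  unfold phi3d4 phi3d5
  refine key.congr_deriv ?_
  rw [show (-(5 / 2) : ℝ) - 1 = -(7 / 2) by norm_num]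
  ring

/-! ### The derivatives of `φ₄` -/

/-- `φ₄⁽¹⁾` in closed form (through `φ₃⁽¹⁾`). [cite: BourgainJAMS2017, §3 eq. (2.19)] -/
def phi4d1 (N₀ M t : ℝ) : ℝ :=
  N₀ ^ (7 / 2 : ℝ) / M ^ 4 *
    (1 / 2 * M * (N₀ + M * t) ^ (-(1 / 2) : ℝ) - 1 / 2 * M / N₀ ^ (1 / 2 : ℝ) +
      1 / 4 * M ^ 2 * t / N₀ ^ (3 / 2 : ℝ) + M ^ 3 / N₀ ^ (5 / 2 : ℝ) * phi3d1 N₀ M t)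

/-- `φ₄⁽²⁾` in closed form. [cite: BourgainJAMS2017, §3 eq. (2.19)] -/
def phi4d2 (N₀ M t : ℝ) : ℝ :=
  N₀ ^ (7 / 2 : ℝ) / M ^ 4 *
    (-(1 / 4) * M ^ 2 * (N₀ + M * t) ^ (-(3 / 2) : ℝ) + 1 / 4 * M ^ 2 / N₀ ^ (3 / 2 : ℝ) +
      M ^ 3 / N₀ ^ (5 / 2 : ℝ) * phi3d2 N₀ M t)

/-- `φ₄⁽³⁾` in closed form. [cite: BourgainJAMS2017, §3 eq. (2.19)] -/
def phi4d3 (N₀ M t : ℝ) : ℝ :=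
  N₀ ^ (7 / 2 : ℝ) / M ^ 4 *
    (3 / 8 * M ^ 3 * (N₀ + M * t) ^ (-(5 / 2) : ℝ) + M ^ 3 / N₀ ^ (5 / 2 : ℝ) * phi3d3 N₀ M t)

/-- `φ₄⁽⁴⁾` in closed form. [cite: BourgainJAMS2017, §3 eq. (2.19)] -/
def phi4d4 (N₀ M t : ℝ) : ℝ :=
  N₀ ^ (7 / 2 : ℝ) / M ^ 4 *
    (-(15 / 16) * M ^ 4 * (N₀ + M * t) ^ (-(7 / 2) : ℝ) + M ^ 3 / N₀ ^ (5 / 2 : ℝ) * phi3d4 N₀ M t)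

/-- `φ₄⁽⁵⁾` in closed form. [cite: BourgainJAMS2017, §3 eq. (2.19)] -/
def phi4d5 (N₀ M t : ℝ) : ℝ :=
  N₀ ^ (7 / 2 : ℝ) / M ^ 4 *
    (105 / 32 * M ^ 5 * (N₀ + M * t) ^ (-(9 / 2) : ℝ) + M ^ 3 / N₀ ^ (5 / 2 : ℝ) * phi3d5 N₀ M t)

/-- `φ₄' = phi4d1`. [folklore] -/
theorem hasDerivAt_phi4 (N₀ M : ℝ) {t : ℝ} (ht : 0 < N₀ + M * t) :
    HasDerivAt (bourgainPhi4 N₀ M) (phi4d1 N₀ M t) t := by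
  have i1 : HasDerivAt (fun t => (N₀ + M * t) ^ (1 / 2 : ℝ) - N₀ ^ (1 / 2 : ℝ))
      (M * (1 / 2) * (N₀ + M * t) ^ ((1 / 2 : ℝ) - 1)) t :=
    (hasDerivAt_rpow_affine N₀ M (1 / 2) ht).sub_const _
  have i2 : HasDerivAt (fun t : ℝ => 1 / 2 * (M * t) / N₀ ^ (1 / 2 : ℝ))
      (1 / 2 * (M * 1) / N₀ ^ (1 / 2 : ℝ)) t :=
    (((hasDerivAt_id' t).const_mul M).const_mul _).div_const _
  have i3 : HasDerivAt (fun t : ℝ => 1 / 8 * (M * t) ^ 2 / N₀ ^ (3 / 2 : ℝ))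
      (1 / 8 * ((2 : ℕ) * (M * t) ^ (2 - 1) * (M * 1)) / N₀ ^ (3 / 2 : ℝ)) t :=
    ((((hasDerivAt_id' t).const_mul M).pow 2).const_mul (1 / 8)).div_const _
  have i4 : HasDerivAt (fun t => M ^ 3 / N₀ ^ (5 / 2 : ℝ) * bourgainPhi3 N₀ M t)
      (M ^ 3 / N₀ ^ (5 / 2 : ℝ) * phi3d1 N₀ M t) t :=
    (hasDerivAt_phi3 N₀ M ht).const_mul _
  have key := (((i1.sub i2).add i3).add i4).const_mul (N₀ ^ (7 / 2 : ℝ) / M ^ 4)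
  unfold bourgainPhi4 phi4d1
  refine key.congr_deriv ?_
  rw [show (1 / 2 : ℝ) - 1 = -(1 / 2) by norm_num]
  push_cast
  ring

/-- `phi4d1' = phi4d2`. [folklore] -/
theorem hasDerivAt_phi4d1 (N₀ M : ℝ) {t : ℝ} (ht : 0 < N₀ + M * t) :
    HasDerivAt (phi4d1 N₀ M) (phi4d2 N₀ M t) t := by
  have i1 : HasDerivAt (fun t => 1 / 2 * M * (N₀ + M * t) ^ (-(1 / 2) : ℝ) - 1 / 2 * M / N₀ ^ (1 / 2 : ℝ))
      (1 / 2 * M * (M * (-(1 / 2)) * (N₀ + M * t) ^ ((-(1 / 2) : ℝ) - 1))) t :=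
    ((hasDerivAt_rpow_affine N₀ M (-(1 / 2)) ht).const_mul _).sub_const _
  have i2 : HasDerivAt (fun t : ℝ => 1 / 4 * M ^ 2 * t / N₀ ^ (3 / 2 : ℝ))
      (1 / 4 * M ^ 2 * 1 / N₀ ^ (3 / 2 : ℝ)) t :=
    ((hasDerivAt_id' t).const_mul _).div_const _
  have i3 : HasDerivAt (fun t => M ^ 3 / N₀ ^ (5 / 2 : ℝ) * phi3d1 N₀ M t)
      (M ^ 3 / N₀ ^ (5 / 2 : ℝ) * phi3d2 N₀ M t) t :=
    (hasDerivAt_phi3d1 N₀ M ht).const_mul _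
  have key := ((i1.add i2).add i3).const_mul (N₀ ^ (7 / 2 : ℝ) / M ^ 4)
  unfold phi4d1 phi4d2
  refine key.congr_deriv ?_
  rw [show (-(1 / 2) : ℝ) - 1 = -(3 / 2) by norm_num]
  ring

/-- `phi4d2' = phi4d3`. [folklore] -/
theorem hasDerivAt_phi4d2 (N₀ M : ℝ) {t : ℝ} (ht : 0 < N₀ + M * t) :
    HasDerivAt (phi4d2 N₀ M) (phi4d3 N₀ M t) t := by
  have i1 : HasDerivAt
      (fun t => -(1 / 4) * M ^ 2 * (N₀ + M * t) ^ (-(3 / 2) : ℝ) + 1 / 4 * M ^ 2 / N₀ ^ (3 / 2 : ℝ))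
      (-(1 / 4) * M ^ 2 * (M * (-(3 / 2)) * (N₀ + M * t) ^ ((-(3 / 2) : ℝ) - 1))) t :=
    ((hasDerivAt_rpow_affine N₀ M (-(3 / 2)) ht).const_mul _).add_const _
  have i2 : HasDerivAt (fun t => M ^ 3 / N₀ ^ (5 / 2 : ℝ) * phi3d2 N₀ M t)
      (M ^ 3 / N₀ ^ (5 / 2 : ℝ) * phi3d3 N₀ M t) t :=
    (hasDerivAt_phi3d2 N₀ M ht).const_mul _
  have key := (i1.add i2).const_mul (N₀ ^ (7 / 2 : ℝ) / M ^ 4)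
  unfold phi4d2 phi4d3
  refine key.congr_deriv ?_
  rw [show (-(3 / 2) : ℝ) - 1 = -(5 / 2) by norm_num]
  ring

/-- `phi4d3' = phi4d4`. [folklore] -/
theorem hasDerivAt_phi4d3 (N₀ M : ℝ) {t : ℝ} (ht : 0 < N₀ + M * t) :
    HasDerivAt (phi4d3 N₀ M) (phi4d4 N₀ M t) t := by
  have i1 : HasDerivAt (fun t => 3 / 8 * M ^ 3 * (N₀ + M * t) ^ (-(5 / 2) : ℝ))
      (3 / 8 * M ^ 3 * (M * (-(5 / 2)) * (N₀ + M * t) ^ ((-(5 / 2) : ℝ) - 1))) t :=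
    (hasDerivAt_rpow_affine N₀ M (-(5 / 2)) ht).const_mul _
  have i2 : HasDerivAt (fun t => M ^ 3 / N₀ ^ (5 / 2 : ℝ) * phi3d3 N₀ M t)
      (M ^ 3 / N₀ ^ (5 / 2 : ℝ) * phi3d4 N₀ M t) t :=
    (hasDerivAt_phi3d3 N₀ M ht).const_mul _
  have key := (i1.add i2).const_mul (N₀ ^ (7 / 2 : ℝ) / M ^ 4)
  unfold phi4d3 phi4d4
  refine key.congr_deriv ?_
  rw [show (-(5 / 2) : ℝ) - 1 = -(7 / 2) by norm_num]
  ring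

/-- `phi4d4' = phi4d5`. [folklore] -/
theorem hasDerivAt_phi4d4 (N₀ M : ℝ) {t : ℝ} (ht : 0 < N₀ + M * t) :
    HasDerivAt (phi4d4 N₀ M) (phi4d5 N₀ M t) t := by
  have i1 : HasDerivAt (fun t => -(15 / 16) * M ^ 4 * (N₀ + M * t) ^ (-(7 / 2) : ℝ))
      (-(15 / 16) * M ^ 4 * (M * (-(7 / 2)) * (N₀ + M * t) ^ ((-(7 / 2) : ℝ) - 1))) t :=
    (hasDerivAt_rpow_affine N₀ M (-(7 / 2)) ht).const_mul _
  have i2 : HasDerivAt (fun t => M ^ 3 / N₀ ^ (5 / 2 : ℝ) * phi3d4 N₀ M t)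
      (M ^ 3 / N₀ ^ (5 / 2 : ℝ) * phi3d5 N₀ M t) t :=
    (hasDerivAt_phi3d4 N₀ M ht).const_mul _
  have key := (i1.add i2).const_mul (N₀ ^ (7 / 2 : ℝ) / M ^ 4)
  unfold phi4d4 phi4d5
  refine key.congr_deriv ?_
  rw [show (-(7 / 2) : ℝ) - 1 = -(9 / 2) by norm_num]
  ring


/-! ### Closed forms through `a = N₀^{1/2}`, `b = (N₀ + Mt)^{1/2}` -/

/-- Odd half-integer powers of `w > 0` as powers of `w^{1/2}`. [folklore] -/
theorem rpow_halves_odd {w : ℝ} (h : 0 < w) :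
    w ^ (3 / 2 : ℝ) = (w ^ (1 / 2 : ℝ)) ^ 3 ∧ w ^ (5 / 2 : ℝ) = (w ^ (1 / 2 : ℝ)) ^ 5 ∧
      w ^ (7 / 2 : ℝ) = (w ^ (1 / 2 : ℝ)) ^ 7 ∧ w ^ (9 / 2 : ℝ) = (w ^ (1 / 2 : ℝ)) ^ 9 ∧
        w = (w ^ (1 / 2 : ℝ)) ^ 2 := by
  refine ⟨?_, ?_, ?_, ?_, ?_⟩ <;>
  · rw [← Real.rpow_natCast, ← Real.rpow_mul h.le]; norm_num

/-- The closed forms of the third, fourth and fifth derivatives. [folklore] -/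
theorem closed_forms {N₀ M t : ℝ} (hN₀ : 0 < N₀) (hM : 0 < M) (hw : 0 < N₀ + M * t) :
    phi3d3 N₀ M t = -(3 / 8) * (N₀ ^ (1 / 2 : ℝ)) ^ 3 / ((N₀ + M * t) ^ (1 / 2 : ℝ)) ^ 3 ∧
    phi3d4 N₀ M t = 9 / 16 * M * (N₀ ^ (1 / 2 : ℝ)) ^ 3 / ((N₀ + M * t) ^ (1 / 2 : ℝ)) ^ 5 ∧
    phi3d5 N₀ M t = -(45 / 32) * M ^ 2 * (N₀ ^ (1 / 2 : ℝ)) ^ 3 / ((N₀ + M * t) ^ (1 / 2 : ℝ)) ^ 7 ∧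
    phi4d3 N₀ M t = 3 / 8 * ((N₀ ^ (1 / 2 : ℝ)) ^ 5 / M) *
        ((N₀ ^ (1 / 2 : ℝ)) ^ 2 - ((N₀ + M * t) ^ (1 / 2 : ℝ)) ^ 2) / ((N₀ + M * t) ^ (1 / 2 : ℝ)) ^ 5 ∧
    phi4d4 N₀ M t = (N₀ ^ (1 / 2 : ℝ)) ^ 5 / ((N₀ + M * t) ^ (1 / 2 : ℝ)) ^ 7 *
        (-(15 / 16) * (N₀ ^ (1 / 2 : ℝ)) ^ 2 + 9 / 16 * ((N₀ + M * t) ^ (1 / 2 : ℝ)) ^ 2) ∧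
    phi4d5 N₀ M t = M * (N₀ ^ (1 / 2 : ℝ)) ^ 5 / ((N₀ + M * t) ^ (1 / 2 : ℝ)) ^ 9 *
        (105 / 32 * (N₀ ^ (1 / 2 : ℝ)) ^ 2 - 45 / 32 * ((N₀ + M * t) ^ (1 / 2 : ℝ)) ^ 2) := by
  obtain ⟨ha3, ha5, ha7, -, ha2⟩ := rpow_halves_odd hN₀
  obtain ⟨hb3, hb5, hb7, hb9, hb2⟩ := rpow_halves_odd hw
  set a := N₀ ^ (1 / 2 : ℝ) with ha
  set b := (N₀ + M * t) ^ (1 / 2 : ℝ) with hb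
  have hapos : 0 < a := Real.rpow_pos_of_pos hN₀ _
  have hbpos : 0 < b := Real.rpow_pos_of_pos hw _
  have e3 : (N₀ + M * t) ^ (-(3 / 2) : ℝ) = (b ^ 3)⁻¹ := by rw [Real.rpow_neg hw.le, hb3]
  have e5 : (N₀ + M * t) ^ (-(5 / 2) : ℝ) = (b ^ 5)⁻¹ := by rw [Real.rpow_neg hw.le, hb5]
  have e7 : (N₀ + M * t) ^ (-(7 / 2) : ℝ) = (b ^ 7)⁻¹ := by rw [Real.rpow_neg hw.le, hb7]
  have e9 : (N₀ + M * t) ^ (-(9 / 2) : ℝ) = (b ^ 9)⁻¹ := by rw [Real.rpow_neg hw.le, hb9]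
  unfold phi4d3 phi4d4 phi4d5 phi3d3 phi3d4 phi3d5
  rw [e3, e5, e7, e9, ha3, ha5, ha7]
  have hM0 : M ≠ 0 := hM.ne'
  have ha0 : a ≠ 0 := hapos.ne'
  have hb0 : b ≠ 0 := hbpos.ne'
  refine ⟨?_, ?_, ?_, ?_, ?_, ?_⟩
  all_goals field_simp
  all_goals ring


/-! ### Polynomial inequalities in `a = N₀^{1/2}`, `b = (N₀ + Mt)^{1/2}`

Hypotheses throughout: `0 < a ≤ b`, `b² ≤ (101/100) a²` (from `b² = a² + Mt`, `Mt ≤ M ≤ N₀/100`). -/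

/-- `b³ ≤ 1.0201 a³` under `a ≤ b`, `b² ≤ 1.01 a²`. [folklore] -/
theorem pow3_le {a b : ℝ} (ha : 0 < a) (hab : a ≤ b) (hb2 : b ^ 2 ≤ 101 / 100 * a ^ 2) :
    b ^ 3 ≤ 10201 / 10000 * a ^ 3 := by
  have hb : 0 < b := lt_of_lt_of_le ha hab
  have h4 : b ^ 4 ≤ (101 / 100 * a ^ 2) ^ 2 := by
    rw [show b ^ 4 = (b ^ 2) ^ 2 by ring]
    exact pow_le_pow_left₀ (by positivity) hb2 2
  have key : b ^ 3 * a ≤ 10201 / 10000 * a ^ 3 * a := by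
    calc b ^ 3 * a ≤ b ^ 3 * b := by gcongr
      _ = b ^ 4 := by ring
      _ ≤ (101 / 100 * a ^ 2) ^ 2 := h4
      _ = 10201 / 10000 * a ^ 3 * a := by ring
  exact le_of_mul_le_mul_right key ha

/-- `b⁵ ≤ 1.01³ a⁵`. [folklore] -/
theorem pow5_le {a b : ℝ} (ha : 0 < a) (hab : a ≤ b) (hb2 : b ^ 2 ≤ 101 / 100 * a ^ 2) :
    b ^ 5 ≤ 1030301 / 1000000 * a ^ 5 := by
  have hb : 0 < b := lt_of_lt_of_le ha hab
  have h6 : b ^ 6 ≤ (101 / 100 * a ^ 2) ^ 3 := by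
    rw [show b ^ 6 = (b ^ 2) ^ 3 by ring]
    exact pow_le_pow_left₀ (by positivity) hb2 3
  have key : b ^ 5 * a ≤ 1030301 / 1000000 * a ^ 5 * a := by
    calc b ^ 5 * a ≤ b ^ 5 * b := by gcongr
      _ = b ^ 6 := by ring
      _ ≤ (101 / 100 * a ^ 2) ^ 3 := h6
      _ = 1030301 / 1000000 * a ^ 5 * a := by ring
  exact le_of_mul_le_mul_right key ha

/-- `b⁷ ≤ 1.01⁴ a⁷`. [folklore] -/
theorem pow7_le {a b : ℝ} (ha : 0 < a) (hab : a ≤ b) (hb2 : b ^ 2 ≤ 101 / 100 * a ^ 2) :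
    b ^ 7 ≤ 104060401 / 100000000 * a ^ 7 := by
  have hb : 0 < b := lt_of_lt_of_le ha hab
  have h8 : b ^ 8 ≤ (101 / 100 * a ^ 2) ^ 4 := by
    rw [show b ^ 8 = (b ^ 2) ^ 4 by ring]
    exact pow_le_pow_left₀ (by positivity) hb2 4
  have key : b ^ 7 * a ≤ 104060401 / 100000000 * a ^ 7 * a := by
    calc b ^ 7 * a ≤ b ^ 7 * b := by gcongr
      _ = b ^ 8 := by ring
      _ ≤ (101 / 100 * a ^ 2) ^ 4 := h8
      _ = 104060401 / 100000000 * a ^ 7 * a := by ring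
  exact le_of_mul_le_mul_right key ha

/-- `|φ₃'''| ≤ 1` and `≥ 1/10`. [folklore] -/
theorem bound_d3 {a b : ℝ} (ha : 0 < a) (hab : a ≤ b) (hb2 : b ^ 2 ≤ 101 / 100 * a ^ 2) :
    |-(3 / 8) * a ^ 3 / b ^ 3| ≤ 1 ∧ 1 / 10 ≤ |-(3 / 8) * a ^ 3 / b ^ 3| := by
  have hb : 0 < b := lt_of_lt_of_le ha hab
  have habs : |-(3 / 8) * a ^ 3 / b ^ 3| = 3 / 8 * (a ^ 3 / b ^ 3) := by
    rw [show -(3 / 8) * a ^ 3 / b ^ 3 = -(3 / 8 * (a ^ 3 / b ^ 3)) by ring, abs_neg,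
      abs_of_nonneg (by positivity)]
  rw [habs]
  have hq : a ^ 3 / b ^ 3 ≤ 1 := by
    rw [div_le_one (by positivity)]; gcongr
  have hq' : 10000 / 10201 ≤ a ^ 3 / b ^ 3 := by
    rw [div_le_div_iff₀ (by norm_num) (by positivity)]
    nlinarith [pow3_le ha hab hb2, pow_pos ha 3]
  constructor <;> nlinarith

/-- `|φ₃''''| ≤ 1`. [folklore] -/
theorem bound_d4 {a b M : ℝ} (ha : 0 < a) (hab : a ≤ b) (hM : 0 < M) (hMa : M ≤ a ^ 2 / 100) :
    |9 / 16 * M * a ^ 3 / b ^ 5| ≤ 1 := by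
  have hb : 0 < b := lt_of_lt_of_le ha hab
  rw [abs_of_nonneg (by positivity), div_le_one (by positivity)]
  have h5 : a ^ 5 ≤ b ^ 5 := by gcongr
  nlinarith [pow_pos ha 3]

/-- `|φ₃⁽⁵⁾| ≤ 1`. [folklore] -/
theorem bound_d5 {a b M : ℝ} (ha : 0 < a) (hab : a ≤ b) (hM : 0 < M) (hMa : M ≤ a ^ 2 / 100) :
    |-(45 / 32) * M ^ 2 * a ^ 3 / b ^ 7| ≤ 1 := by
  have hb : 0 < b := lt_of_lt_of_le ha hab
  rw [show -(45 / 32) * M ^ 2 * a ^ 3 / b ^ 7 = -(45 / 32 * M ^ 2 * a ^ 3 / b ^ 7) by ring, abs_neg,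
    abs_of_nonneg (by positivity), div_le_one (by positivity)]
  have h7 : a ^ 7 ≤ b ^ 7 := by gcongr
  have hM2 : M ^ 2 ≤ (a ^ 2 / 100) ^ 2 := pow_le_pow_left₀ hM.le hMa 2
  nlinarith [pow_pos ha 3, mul_le_mul_of_nonneg_right hM2 (pow_pos ha 3).le]

/-- `|φ₄'''| ≤ 1`. [folklore] -/
theorem bound_e3 {a b M t : ℝ} (ha : 0 < a) (hab : a ≤ b) (hM : 0 < M) (ht0 : 0 ≤ t) (ht1 : t ≤ 1)
    (hbt : b ^ 2 = a ^ 2 + M * t) :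
    |3 / 8 * (a ^ 5 / M) * (a ^ 2 - b ^ 2) / b ^ 5| ≤ 1 := by
  have hb : 0 < b := lt_of_lt_of_le ha hab
  have e : 3 / 8 * (a ^ 5 / M) * (a ^ 2 - b ^ 2) / b ^ 5 = -(3 / 8 * t * (a ^ 5 / b ^ 5)) := by
    rw [show a ^ 2 - b ^ 2 = -(M * t) by linarith]
    field_simp
  rw [e, abs_neg, abs_of_nonneg (by positivity)]
  have hq : a ^ 5 / b ^ 5 ≤ 1 := by
    rw [div_le_one (by positivity)]; gcongr
  nlinarith [div_nonneg (pow_pos ha 5).le (pow_pos hb 5).le]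

/-- `|φ₄''''| ≤ 1`. [folklore] -/
theorem bound_e4 {a b : ℝ} (ha : 0 < a) (hab : a ≤ b) :
    |a ^ 5 / b ^ 7 * (-(15 / 16) * a ^ 2 + 9 / 16 * b ^ 2)| ≤ 1 := by
  have hb : 0 < b := lt_of_lt_of_le ha hab
  rw [abs_le]
  have h7 : a ^ 7 ≤ b ^ 7 := by gcongr
  have hq : a ^ 5 / b ^ 7 = (a ^ 5 / b ^ 5) / b ^ 2 := by field_simp
  have hq1 : a ^ 5 / b ^ 5 ≤ 1 := by
    rw [div_le_one (by positivity)]; gcongr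
  have hq0 : 0 ≤ a ^ 5 / b ^ 5 := by positivity
  have hbr : -(15 / 16) * a ^ 2 + 9 / 16 * b ^ 2 ≤ 9 / 16 * b ^ 2 := by nlinarith [sq_nonneg a]
  have hbr' : -(15 / 16) * b ^ 2 ≤ -(15 / 16) * a ^ 2 + 9 / 16 * b ^ 2 := by nlinarith
  constructor
  · calc (-1 : ℝ) ≤ (a ^ 5 / b ^ 5) / b ^ 2 * (-(15 / 16) * b ^ 2) := by
          rw [show (a ^ 5 / b ^ 5) / b ^ 2 * (-(15 / 16) * b ^ 2) = -(15 / 16) * (a ^ 5 / b ^ 5) by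
            field_simp]
          nlinarith
      _ ≤ (a ^ 5 / b ^ 5) / b ^ 2 * (-(15 / 16) * a ^ 2 + 9 / 16 * b ^ 2) := by
          rw [hq] at *
          exact mul_le_mul_of_nonneg_left hbr' (by positivity)
      _ = _ := by rw [hq]
  · calc a ^ 5 / b ^ 7 * (-(15 / 16) * a ^ 2 + 9 / 16 * b ^ 2)
        ≤ a ^ 5 / b ^ 7 * (9 / 16 * b ^ 2) := mul_le_mul_of_nonneg_left hbr (by positivity)
      _ = 9 / 16 * (a ^ 5 / b ^ 5) := by field_simp
      _ ≤ 1 := by nlinarith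

/-- `|φ₄⁽⁵⁾| ≤ 1`. [folklore] -/
theorem bound_e5 {a b M : ℝ} (ha : 0 < a) (hab : a ≤ b) (hM : 0 < M) (hMa : M ≤ a ^ 2 / 100) :
    |M * a ^ 5 / b ^ 9 * (105 / 32 * a ^ 2 - 45 / 32 * b ^ 2)| ≤ 1 := by
  have hb : 0 < b := lt_of_lt_of_le ha hab
  rw [abs_mul, abs_of_nonneg (by positivity : (0 : ℝ) ≤ M * a ^ 5 / b ^ 9)]
  have hbr : |105 / 32 * a ^ 2 - 45 / 32 * b ^ 2| ≤ 105 / 32 * b ^ 2 := by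
    rw [abs_le]; constructor <;> nlinarith [pow_le_pow_left₀ ha.le hab 2]
  calc M * a ^ 5 / b ^ 9 * |105 / 32 * a ^ 2 - 45 / 32 * b ^ 2|
      ≤ M * a ^ 5 / b ^ 9 * (105 / 32 * b ^ 2) := mul_le_mul_of_nonneg_left hbr (by positivity)
    _ = 105 / 32 * (M / b ^ 2) * (a ^ 5 / b ^ 5) := by field_simp
    _ ≤ 105 / 32 * (1 / 100) * 1 := by
        have h1 : M / b ^ 2 ≤ 1 / 100 := by
          rw [div_le_div_iff₀ (by positivity) (by norm_num)]
          nlinarith [pow_le_pow_left₀ ha.le hab 2]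
        have h2 : a ^ 5 / b ^ 5 ≤ 1 := by
          rw [div_le_one (by positivity)]; gcongr
        gcongr
    _ ≤ 1 := by norm_num

/-- The Wronskian lower bound `φ₃'''(s) φ₄''''(t) - φ₄'''(s) φ₃''''(t) ≥ 1/10`. [folklore] -/
theorem wronskian_lower {a bs bt M : ℝ} (ha : 0 < a) (hs : a ≤ bs) (ht : a ≤ bt)
    (hbs2 : bs ^ 2 ≤ 101 / 100 * a ^ 2) (hbt2 : bt ^ 2 ≤ 101 / 100 * a ^ 2) (hM : 0 < M) :
    1 / 10 ≤ (-(3 / 8) * a ^ 3 / bs ^ 3) * (a ^ 5 / bt ^ 7 * (-(15 / 16) * a ^ 2 + 9 / 16 * bt ^ 2)) -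
      (3 / 8 * (a ^ 5 / M) * (a ^ 2 - bs ^ 2) / bs ^ 5) * (9 / 16 * M * a ^ 3 / bt ^ 5) := by
  have hbs' : 0 < bs := lt_of_lt_of_le ha hs
  have hbt' : 0 < bt := lt_of_lt_of_le ha ht
  -- write as a single fraction
  have e : (-(3 / 8) * a ^ 3 / bs ^ 3) * (a ^ 5 / bt ^ 7 * (-(15 / 16) * a ^ 2 + 9 / 16 * bt ^ 2)) -
      (3 / 8 * (a ^ 5 / M) * (a ^ 2 - bs ^ 2) / bs ^ 5) * (9 / 16 * M * a ^ 3 / bt ^ 5) =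
      (3 / 8 * a ^ 8 * bs ^ 2 * (15 / 16 * a ^ 2 - 9 / 16 * bt ^ 2) +
        27 / 128 * a ^ 8 * (bs ^ 2 - a ^ 2) * bt ^ 2) / (bs ^ 5 * bt ^ 7) := by
    field_simp
    ring
  rw [e, le_div_iff₀ (by positivity)]
  -- numerator from below
  have hbr : 591 / 1600 * a ^ 2 ≤ 15 / 16 * a ^ 2 - 9 / 16 * bt ^ 2 := by nlinarith
  have h1 : 3 / 8 * a ^ 8 * a ^ 2 * (591 / 1600 * a ^ 2) ≤
      3 / 8 * a ^ 8 * bs ^ 2 * (15 / 16 * a ^ 2 - 9 / 16 * bt ^ 2) := by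
    have hbs2' : a ^ 2 ≤ bs ^ 2 := pow_le_pow_left₀ ha.le hs 2
    have := mul_le_mul hbs2' hbr (by positivity) (by positivity)
    nlinarith [pow_pos ha 8]
  have h2 : 0 ≤ 27 / 128 * a ^ 8 * (bs ^ 2 - a ^ 2) * bt ^ 2 := by
    have : 0 ≤ bs ^ 2 - a ^ 2 := by nlinarith [pow_le_pow_left₀ ha.le hs 2]
    positivity
  -- denominator from above
  have hD : bs ^ 5 * bt ^ 7 ≤ (1030301 / 1000000 * a ^ 5) * (104060401 / 100000000 * a ^ 7) :=
    mul_le_mul (pow5_le ha hs hbs2) (pow7_le ha ht hbt2) (by positivity) (by positivity)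
  nlinarith [pow_pos ha 12]


/-! ### Values at `t = 0` -/

/-- `φ₃, φ₃⁽¹⁾, φ₃⁽²⁾, φ₄, φ₄⁽¹⁾, φ₄⁽²⁾` vanish at `t = 0` (Taylor remainders). [folklore] -/
theorem values_at_zero {N₀ M : ℝ} (hN₀ : 0 < N₀) :
    bourgainPhi3 N₀ M 0 = 0 ∧ phi3d1 N₀ M 0 = 0 ∧ phi3d2 N₀ M 0 = 0 ∧
      bourgainPhi4 N₀ M 0 = 0 ∧ phi4d1 N₀ M 0 = 0 ∧ phi4d2 N₀ M 0 = 0 := by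
  have h1 : bourgainPhi3 N₀ M 0 = 0 := by
    unfold bourgainPhi3; simp
  have h2 : phi3d1 N₀ M 0 = 0 := by
    unfold phi3d1; simp; right; ring
  have h3 : phi3d2 N₀ M 0 = 0 := by
    unfold phi3d2
    simp only [mul_zero, add_zero]
    rw [Real.rpow_neg hN₀.le, div_eq_mul_inv (3 / 4 * M ^ 2)]
    ring
  refine ⟨h1, h2, h3, ?_, ?_, ?_⟩
  · unfold bourgainPhi4; rw [h1]; simp
  · unfold phi4d1; rw [h2]
    simp only [mul_zero, add_zero, zero_div]
    rw [Real.rpow_neg hN₀.le, div_eq_mul_inv (1 / 2 * M)]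
    ring
  · unfold phi4d2; rw [h3]
    simp only [mul_zero, add_zero]
    rw [Real.rpow_neg hN₀.le, div_eq_mul_inv (1 / 4 * M ^ 2)]
    ring

/-! ### From a bounded derivative and a zero at `0` to a bound on `[0, 1]` -/

/-- Mean value inequality on `[0,1]`: `f(0) = 0` and `|f'| ≤ 1` give `|f| ≤ 1`. [folklore] -/
theorem abs_le_one_of_deriv {f f' : ℝ → ℝ} (hf : ∀ x ∈ Set.Icc (0 : ℝ) 1, HasDerivAt f (f' x) x)
    (h0 : f 0 = 0) (hb : ∀ x ∈ Set.Icc (0 : ℝ) 1, |f' x| ≤ 1) :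
    ∀ t ∈ Set.Icc (0 : ℝ) 1, |f t| ≤ 1 := by
  intro t ht
  have key := norm_image_sub_le_of_norm_deriv_le_segment' (f := f) (f' := f') (a := 0) (b := 1)
    (C := 1) (fun x hx => (hf x hx).hasDerivWithinAt)
    (fun x hx => by simpa [Real.norm_eq_abs] using hb x (Set.Ico_subset_Icc_self hx)) t ht
  rw [h0, sub_zero, Real.norm_eq_abs] at key
  have : t ≤ 1 := ht.2
  linarith


end BourgainTaylorCurve

open BourgainTaylorCurve in
/-- **Bourgain 2017, (2.10) ⟹ its instance (2.22) for the Taylor curve: the curve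
`Φ(t) = (t, t², φ₃(t), φ₄(t))` of (2.18)–(2.19) satisfies (2.11), uniformly** ("`φ₃(t) ∼ t³(1 + O(M/N₀)t + ⋯)`,
`φ₄(t) ∼ t⁴`. Hence `Φ(t) = (t, t², φ₃(t), φ₄(t))` satisfies (2.11)", p. 9 — PROVED here with explicit
constants). Hypothesis `h210` = the printed decoupling bound (2.10) for curves `Φ = (t, t², φ₃, φ₄)`
satisfying (2.11), written out with quantitative data: for every `ε > 0`, every lower bound `c > 0` in
(2.11) and every bound `B` on the first five derivatives, a constant `C = C(ε, c, B)` such that for all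
`φ₃, φ₄ : ℝ → ℝ` with five successive derivatives `φ₃₁, …, φ₃₅`, `φ₄₁, …, φ₄₅` on `[0,1]`
(`HasDerivAt` chains), `|φ^{(k)}| ≤ B` on `[0,1]` (`k ≤ 5`), `|φ₃⁽³⁾| ≥ c` ((2.3)) and
`|φ₃⁽³⁾(s) φ₄⁽⁴⁾(t) - φ₄⁽³⁾(s) φ₃⁽⁴⁾(t)| ≥ c` on `[0,1]²` (the Wronskian condition (1.1)/(2.11)), and
for all `M ≥ 1`, blocks `[a,b], [a',b'] ⊂ [0,M]` with `b < a'`, `M ≤ 4(a' - b)`, and translates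
`c₀, c₀'`: `∫_{[0,1]²×[c₀,c₀+M²]×[c₀',c₀'+M]} |∑_{m=a}^{b} e(m y₁ + m² y₂ + φ₃(m/M) y₃ + φ₄(m/M) y₄)|⁶ ·`
`|∑_{m=a'}^{b'} …|⁶ dy ≤ C M^{9+ε}` ("`‖∏_j |∑_{n∈I_j} a_n e(Φ(n/N)·x)|^{1/2}‖_{L¹²_#(Ω̃)} ≪ N^{1/2+ε}‖ā‖_∞`
(2.10) with `Φ` satisfying (1.1), (2.2), (2.3), i.e. (2.11)", in the coordinates of (2.22), indicator
coefficients, translates of `Ω̃`; the implied constant depends on `ε` and on the curve only through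
(2.11) and finitely many derivatives). Conclusion = the hypothesis `h222` of
`Literature.NumberTheory.LFunctions.Bourgain2017_eq223_of_eq222` (the same bound for
`ψ = bourgainTaylorPhase N₀ M`, uniformly in `N₀ > 100 M`). Proof: the derivatives of `φ₃`, `φ₄` in
closed form (`BourgainTaylorCurve.hasDerivAt_phi3` … `closed_forms`), the bounds `|φ^{(k)}| ≤ 1`
(`k = 3, 4, 5` directly in `a = N₀^{1/2}`, `b = (N₀+Mt)^{1/2}` with `b² ≤ 1.01 a²`; `k ≤ 2` by the mean
value inequality from the zeros at `t = 0`), `|φ₃⁽³⁾| = (3/8)(a/b)³ ≥ 1/10`, and the Wronskian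
`φ₃⁽³⁾φ₄⁽⁴⁾ - φ₄⁽³⁾φ₃⁽⁴⁾ = (3/8)(a⁸/(b_s³b_t⁷))((15/16)a² - (9/16)b_t²) + (27/128)a⁸(b_s² - a²)/(b_s⁵b_t⁵) ≥ 1/10`
(`BourgainTaylorCurve.wronskian_lower`); so `h210` applies with `c = 1/10`, `B = 1`.
[cite: BourgainJAMS2017, §3 eqs. (2.10), (2.11), (2.18)–(2.22)] -/
theorem Bourgain2017_eq222_of_eq210
    (hgen : ∀ ε c B : ℝ, 0 < ε → 0 < c → ∃ C : ℝ,
      ∀ (φ₃ φ₃₁ φ₃₂ φ₃₃ φ₃₄ φ₃₅ φ₄ φ₄₁ φ₄₂ φ₄₃ φ₄₄ φ₄₅ : ℝ → ℝ),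
        (∀ t ∈ Set.Icc (0 : ℝ) 1,
          HasDerivAt φ₃ (φ₃₁ t) t ∧ HasDerivAt φ₃₁ (φ₃₂ t) t ∧ HasDerivAt φ₃₂ (φ₃₃ t) t ∧
            HasDerivAt φ₃₃ (φ₃₄ t) t ∧ HasDerivAt φ₃₄ (φ₃₅ t) t ∧
          HasDerivAt φ₄ (φ₄₁ t) t ∧ HasDerivAt φ₄₁ (φ₄₂ t) t ∧ HasDerivAt φ₄₂ (φ₄₃ t) t ∧
            HasDerivAt φ₄₃ (φ₄₄ t) t ∧ HasDerivAt φ₄₄ (φ₄₅ t) t) →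
        (∀ t ∈ Set.Icc (0 : ℝ) 1,
          |φ₃ t| ≤ B ∧ |φ₃₁ t| ≤ B ∧ |φ₃₂ t| ≤ B ∧ |φ₃₃ t| ≤ B ∧ |φ₃₄ t| ≤ B ∧ |φ₃₅ t| ≤ B ∧
          |φ₄ t| ≤ B ∧ |φ₄₁ t| ≤ B ∧ |φ₄₂ t| ≤ B ∧ |φ₄₃ t| ≤ B ∧ |φ₄₄ t| ≤ B ∧ |φ₄₅ t| ≤ B) →
        (∀ t ∈ Set.Icc (0 : ℝ) 1, c ≤ |φ₃₃ t|) →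
        (∀ s ∈ Set.Icc (0 : ℝ) 1, ∀ t ∈ Set.Icc (0 : ℝ) 1,
          c ≤ |φ₃₃ s * φ₄₄ t - φ₄₃ s * φ₃₄ t|) →
        ∀ M : ℕ, 1 ≤ M → ∀ a b a' b' : ℕ, a ≤ b → b < a' → a' ≤ b' → b' ≤ M →
          (M : ℝ) ≤ 4 * ((a' : ℝ) - b) → ∀ c₀ c₀' : ℝ,
          (∫ y in Set.Icc ![0, 0, c₀, c₀'] ![1, 1, c₀ + (M : ℝ) ^ 2, c₀' + M],
            ‖∑ m ∈ Finset.Icc a b, Complex.exp (2 * ↑π * I *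
                ↑((m : ℝ) * y 0 + (m : ℝ) ^ 2 * y 1 + φ₃ ((m : ℝ) / M) * y 2 + φ₄ ((m : ℝ) / M) * y 3))‖ ^ 6 *
              ‖∑ m ∈ Finset.Icc a' b', Complex.exp (2 * ↑π * I *
                ↑((m : ℝ) * y 0 + (m : ℝ) ^ 2 * y 1 + φ₃ ((m : ℝ) / M) * y 2 + φ₄ ((m : ℝ) / M) * y 3))‖ ^ 6) ≤
            C * (M : ℝ) ^ (9 + ε)) :
    ∀ ε : ℝ, 0 < ε → ∃ C : ℝ, ∀ N₀ M : ℕ, 1 ≤ M → 100 * M < N₀ →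
      ∀ a b a' b' : ℕ, a ≤ b → b < a' → a' ≤ b' → b' ≤ M → (M : ℝ) ≤ 4 * ((a' : ℝ) - b) →
      ∀ c c' : ℝ,
        (∫ y in Set.Icc ![0, 0, c, c'] ![1, 1, c + (M : ℝ) ^ 2, c' + M],
          ‖∑ m ∈ Finset.Icc a b,
              Complex.exp (2 * ↑π * I * ↑(bourgainTaylorPhase N₀ M m y))‖ ^ 6 *
            ‖∑ m ∈ Finset.Icc a' b',
              Complex.exp (2 * ↑π * I * ↑(bourgainTaylorPhase N₀ M m y))‖ ^ 6) ≤
          C * (M : ℝ) ^ (9 + ε) := by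
  intro ε hε
  obtain ⟨C, hC⟩ := hgen ε (1 / 10) 1 hε (by norm_num)
  refine ⟨C, fun N₀ M hM h100 a b a' b' hab hba' ha'b' hb' hsep c₀ c₀' => ?_⟩
  have hMpos : (0 : ℝ) < M := by exact_mod_cast hM
  have hN₀pos : (0 : ℝ) < N₀ := by exact_mod_cast (show 0 < N₀ by omega)
  have hMN : (M : ℝ) ≤ (N₀ : ℝ) / 100 := by
    rw [le_div_iff₀ (by norm_num)]; exact_mod_cast (by omega : M * 100 ≤ N₀)
  have hw : ∀ t ∈ Set.Icc (0 : ℝ) 1, (0 : ℝ) < N₀ + M * t := fun t ht => by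
    have : 0 ≤ (M : ℝ) * t := mul_nonneg hMpos.le ht.1
    linarith
  -- the basic inequalities in `a = N₀^{1/2}`, `b = (N₀ + Mt)^{1/2}`
  have hfacts : ∀ t ∈ Set.Icc (0 : ℝ) 1,
      0 < (N₀ : ℝ) ^ (1 / 2 : ℝ) ∧ (N₀ : ℝ) ^ (1 / 2 : ℝ) ≤ ((N₀ : ℝ) + M * t) ^ (1 / 2 : ℝ) ∧
      (((N₀ : ℝ) + M * t) ^ (1 / 2 : ℝ)) ^ 2 ≤ 101 / 100 * ((N₀ : ℝ) ^ (1 / 2 : ℝ)) ^ 2 ∧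
      (M : ℝ) ≤ ((N₀ : ℝ) ^ (1 / 2 : ℝ)) ^ 2 / 100 ∧
      (((N₀ : ℝ) + M * t) ^ (1 / 2 : ℝ)) ^ 2 = ((N₀ : ℝ) ^ (1 / 2 : ℝ)) ^ 2 + M * t := by
    intro t ht
    have ha2 : ((N₀ : ℝ) ^ (1 / 2 : ℝ)) ^ 2 = N₀ := (rpow_halves_odd hN₀pos).2.2.2.2.symm
    have hb2 : (((N₀ : ℝ) + M * t) ^ (1 / 2 : ℝ)) ^ 2 = N₀ + M * t :=
      (rpow_halves_odd (hw t ht)).2.2.2.2.symm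
    refine ⟨Real.rpow_pos_of_pos hN₀pos _, ?_, ?_, ?_, ?_⟩
    · exact Real.rpow_le_rpow hN₀pos.le (by nlinarith [mul_nonneg hMpos.le ht.1]) (by norm_num)
    · rw [ha2, hb2]
      have : (M : ℝ) * t ≤ M := mul_le_of_le_one_right hMpos.le ht.2
      linarith
    · rw [ha2]; exact hMN
    · rw [ha2, hb2]
  -- orders 3, 4, 5
  have hd3 : ∀ t ∈ Set.Icc (0 : ℝ) 1, |phi3d3 N₀ M t| ≤ 1 ∧ 1 / 10 ≤ |phi3d3 N₀ M t| := by
    intro t ht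
    obtain ⟨ha, hab', hb2, -, -⟩ := hfacts t ht
    rw [(closed_forms hN₀pos hMpos (hw t ht)).1]
    exact bound_d3 ha hab' hb2
  have hd4 : ∀ t ∈ Set.Icc (0 : ℝ) 1, |phi3d4 N₀ M t| ≤ 1 := by
    intro t ht
    obtain ⟨ha, hab', -, hMa, -⟩ := hfacts t ht
    rw [(closed_forms hN₀pos hMpos (hw t ht)).2.1]
    exact bound_d4 ha hab' hMpos hMa
  have hd5 : ∀ t ∈ Set.Icc (0 : ℝ) 1, |phi3d5 N₀ M t| ≤ 1 := by
    intro t ht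
    obtain ⟨ha, hab', -, hMa, -⟩ := hfacts t ht
    rw [(closed_forms hN₀pos hMpos (hw t ht)).2.2.1]
    exact bound_d5 ha hab' hMpos hMa
  have he3 : ∀ t ∈ Set.Icc (0 : ℝ) 1, |phi4d3 N₀ M t| ≤ 1 := by
    intro t ht
    obtain ⟨ha, hab', -, -, hbt⟩ := hfacts t ht
    rw [(closed_forms hN₀pos hMpos (hw t ht)).2.2.2.1]
    exact bound_e3 ha hab' hMpos ht.1 ht.2 hbt
  have he4 : ∀ t ∈ Set.Icc (0 : ℝ) 1, |phi4d4 N₀ M t| ≤ 1 := by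
    intro t ht
    obtain ⟨ha, hab', -, -, -⟩ := hfacts t ht
    rw [(closed_forms hN₀pos hMpos (hw t ht)).2.2.2.2.1]
    exact bound_e4 ha hab'
  have he5 : ∀ t ∈ Set.Icc (0 : ℝ) 1, |phi4d5 N₀ M t| ≤ 1 := by
    intro t ht
    obtain ⟨ha, hab', -, hMa, -⟩ := hfacts t ht
    rw [(closed_forms hN₀pos hMpos (hw t ht)).2.2.2.2.2]
    exact bound_e5 ha hab' hMpos hMa
  -- orders 2, 1, 0 by the mean value inequality
  obtain ⟨z0, z1, z2, w0, w1, w2⟩ := values_at_zero (M := (M : ℝ)) hN₀pos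
  have hd2 : ∀ t ∈ Set.Icc (0 : ℝ) 1, |phi3d2 N₀ M t| ≤ 1 :=
    abs_le_one_of_deriv (fun t ht => hasDerivAt_phi3d2 _ _ (hw t ht)) z2 (fun t ht => (hd3 t ht).1)
  have hd1 : ∀ t ∈ Set.Icc (0 : ℝ) 1, |phi3d1 N₀ M t| ≤ 1 :=
    abs_le_one_of_deriv (fun t ht => hasDerivAt_phi3d1 _ _ (hw t ht)) z1 hd2
  have hd0 : ∀ t ∈ Set.Icc (0 : ℝ) 1, |bourgainPhi3 N₀ M t| ≤ 1 :=
    abs_le_one_of_deriv (fun t ht => hasDerivAt_phi3 _ _ (hw t ht)) z0 hd1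
  have he2 : ∀ t ∈ Set.Icc (0 : ℝ) 1, |phi4d2 N₀ M t| ≤ 1 :=
    abs_le_one_of_deriv (fun t ht => hasDerivAt_phi4d2 _ _ (hw t ht)) w2 he3
  have he1 : ∀ t ∈ Set.Icc (0 : ℝ) 1, |phi4d1 N₀ M t| ≤ 1 :=
    abs_le_one_of_deriv (fun t ht => hasDerivAt_phi4d1 _ _ (hw t ht)) w1 he2
  have he0 : ∀ t ∈ Set.Icc (0 : ℝ) 1, |bourgainPhi4 N₀ M t| ≤ 1 :=
    abs_le_one_of_deriv (fun t ht => hasDerivAt_phi4 _ _ (hw t ht)) w0 he1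
  -- the Wronskian
  have hW : ∀ s ∈ Set.Icc (0 : ℝ) 1, ∀ t ∈ Set.Icc (0 : ℝ) 1,
      1 / 10 ≤ |phi3d3 N₀ M s * phi4d4 N₀ M t - phi4d3 N₀ M s * phi3d4 N₀ M t| := by
    intro s hs t ht
    obtain ⟨ha, has, hbs2, -, -⟩ := hfacts s hs
    obtain ⟨-, hat, hbt2, -, -⟩ := hfacts t ht
    obtain ⟨cs3, -, -, cs4', -, -⟩ := closed_forms hN₀pos hMpos (hw s hs)
    obtain ⟨-, ct4, -, -, ct4', -⟩ := closed_forms hN₀pos hMpos (hw t ht)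
    rw [cs3, cs4', ct4, ct4']
    exact le_trans (wronskian_lower ha has hat hbs2 hbt2 hMpos) (le_abs_self _)
  have key := hC (bourgainPhi3 N₀ M) (phi3d1 N₀ M) (phi3d2 N₀ M) (phi3d3 N₀ M) (phi3d4 N₀ M)
    (phi3d5 N₀ M) (bourgainPhi4 N₀ M) (phi4d1 N₀ M) (phi4d2 N₀ M) (phi4d3 N₀ M) (phi4d4 N₀ M)
    (phi4d5 N₀ M)
    (fun t ht => ⟨hasDerivAt_phi3 _ _ (hw t ht), hasDerivAt_phi3d1 _ _ (hw t ht),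
      hasDerivAt_phi3d2 _ _ (hw t ht), hasDerivAt_phi3d3 _ _ (hw t ht),
      hasDerivAt_phi3d4 _ _ (hw t ht), hasDerivAt_phi4 _ _ (hw t ht),
      hasDerivAt_phi4d1 _ _ (hw t ht), hasDerivAt_phi4d2 _ _ (hw t ht),
      hasDerivAt_phi4d3 _ _ (hw t ht), hasDerivAt_phi4d4 _ _ (hw t ht)⟩)
    (fun t ht => ⟨hd0 t ht, hd1 t ht, hd2 t ht, (hd3 t ht).1, hd4 t ht, hd5 t ht,
      he0 t ht, he1 t ht, he2 t ht, he3 t ht, he4 t ht, he5 t ht⟩)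
    (fun t ht => (hd3 t ht).2) hW M hM a b a' b' hab hba' ha'b' hb' hsep c₀ c₀'
  simpa only [bourgainTaylorPhase] using key


/-- **Bourgain 2017, Theorem 2 (2.12) from the decoupling bound (2.10)/(2.22)**: the composition
of `Bourgain2017_eq223_of_eq222` ((2.13)–(2.23), this file) with
`Literature.NumberTheory.LFunctions.Bourgain2017_theorem2_of_eq223` ((2.24)–(2.27),
`BourgainTheorem2Induction.lean`). [cite: BourgainJAMS2017, Theorem 2, eq. (2.12); §3] -/
theorem Bourgain2017_theorem2_of_eq222
    (h222 : ∀ ε : ℝ, 0 < ε → ∃ C : ℝ, ∀ N₀ M : ℕ, 1 ≤ M → 100 * M < N₀ →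
      ∀ a b a' b' : ℕ, a ≤ b → b < a' → a' ≤ b' → b' ≤ M → (M : ℝ) ≤ 4 * ((a' : ℝ) - b) →
      ∀ c c' : ℝ,
        (∫ y in Set.Icc ![0, 0, c, c'] ![1, 1, c + (M : ℝ) ^ 2, c' + M],
          ‖∑ m ∈ Finset.Icc a b,
              Complex.exp (2 * ↑π * I * ↑(bourgainTaylorPhase N₀ M m y))‖ ^ 6 *
            ‖∑ m ∈ Finset.Icc a' b',
              Complex.exp (2 * ↑π * I * ↑(bourgainTaylorPhase N₀ M m y))‖ ^ 6) ≤
          C * (M : ℝ) ^ (9 + ε)) :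
    ∀ ε : ℝ, 0 < ε → ∃ C : ℝ, ∀ N : ℕ, 1 ≤ N →
      bourgainA6 N (1 / (N : ℝ) ^ 2) (1 / N) ≤ C * (N : ℝ) ^ (6 + ε) :=
  Bourgain2017_theorem2_of_eq223 (Bourgain2017_eq223_of_eq222 h222)

/-- **Bourgain 2017, Corollary 3 (2.28) from the decoupling bound (2.10)/(2.22)**: the composition
of `Bourgain2017_theorem2_of_eq222` with the rescaling
`Literature.NumberTheory.LFunctions.Bourgain2017_corollary3_of_theorem2`. The conclusion is literally
the hypothesis `hC3` of `Literature.NumberTheory.LFunctions.Bourgain2017_theorem4_log_of_reduction`;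
after this file the part of Corollary 3 that remains an assumption in the discharge of
`Literature.NumberTheory.LFunctions.Bourgain2017_theorem4_log` is exactly the decoupling bound
(2.10) for the curve of (2.22) (Theorem 1 of the paper for `d = 4` and the Bourgain–Demeter `L⁶`
decoupling (1.5), eqs. (2.1)–(2.10)). [cite: BourgainJAMS2017, Corollary 3, eq. (2.28); §3] -/
theorem Bourgain2017_corollary3_of_eq222
    (h222 : ∀ ε : ℝ, 0 < ε → ∃ C : ℝ, ∀ N₀ M : ℕ, 1 ≤ M → 100 * M < N₀ →
      ∀ a b a' b' : ℕ, a ≤ b → b < a' → a' ≤ b' → b' ≤ M → (M : ℝ) ≤ 4 * ((a' : ℝ) - b) →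
      ∀ c c' : ℝ,
        (∫ y in Set.Icc ![0, 0, c, c'] ![1, 1, c + (M : ℝ) ^ 2, c' + M],
          ‖∑ m ∈ Finset.Icc a b,
              Complex.exp (2 * ↑π * I * ↑(bourgainTaylorPhase N₀ M m y))‖ ^ 6 *
            ‖∑ m ∈ Finset.Icc a' b',
              Complex.exp (2 * ↑π * I * ↑(bourgainTaylorPhase N₀ M m y))‖ ^ 6) ≤
          C * (M : ℝ) ^ (9 + ε)) :
    ∀ ε : ℝ, 0 < ε → ∃ C : ℝ, ∀ N : ℕ, 1 ≤ N → ∀ δ Δ : ℝ,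
      1 / (N : ℝ) ^ 2 ≤ δ → δ ≤ 1 → 1 / (N : ℝ) ≤ Δ → Δ ≤ 1 →
        bourgainA6 N δ Δ ≤ C * δ * Δ * (N : ℝ) ^ (9 + ε) :=
  Bourgain2017_corollary3_of_theorem2 (Bourgain2017_theorem2_of_eq222 h222)


/-- **Bourgain 2017, the bilinear estimate (2.23) from the general decoupling bound (2.10)** —
composition of `Bourgain2017_eq222_of_eq210` and `Bourgain2017_eq223_of_eq222`.
[cite: BourgainJAMS2017, §3 eqs. (2.10)–(2.23)] -/
theorem Bourgain2017_eq223_of_eq210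
    (h210 : ∀ ε c B : ℝ, 0 < ε → 0 < c → ∃ C : ℝ,
      ∀ (φ₃ φ₃₁ φ₃₂ φ₃₃ φ₃₄ φ₃₅ φ₄ φ₄₁ φ₄₂ φ₄₃ φ₄₄ φ₄₅ : ℝ → ℝ),
        (∀ t ∈ Set.Icc (0 : ℝ) 1,
          HasDerivAt φ₃ (φ₃₁ t) t ∧ HasDerivAt φ₃₁ (φ₃₂ t) t ∧ HasDerivAt φ₃₂ (φ₃₃ t) t ∧
            HasDerivAt φ₃₃ (φ₃₄ t) t ∧ HasDerivAt φ₃₄ (φ₃₅ t) t ∧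
          HasDerivAt φ₄ (φ₄₁ t) t ∧ HasDerivAt φ₄₁ (φ₄₂ t) t ∧ HasDerivAt φ₄₂ (φ₄₃ t) t ∧
            HasDerivAt φ₄₃ (φ₄₄ t) t ∧ HasDerivAt φ₄₄ (φ₄₅ t) t) →
        (∀ t ∈ Set.Icc (0 : ℝ) 1,
          |φ₃ t| ≤ B ∧ |φ₃₁ t| ≤ B ∧ |φ₃₂ t| ≤ B ∧ |φ₃₃ t| ≤ B ∧ |φ₃₄ t| ≤ B ∧ |φ₃₅ t| ≤ B ∧
          |φ₄ t| ≤ B ∧ |φ₄₁ t| ≤ B ∧ |φ₄₂ t| ≤ B ∧ |φ₄₃ t| ≤ B ∧ |φ₄₄ t| ≤ B ∧ |φ₄₅ t| ≤ B) →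
        (∀ t ∈ Set.Icc (0 : ℝ) 1, c ≤ |φ₃₃ t|) →
        (∀ s ∈ Set.Icc (0 : ℝ) 1, ∀ t ∈ Set.Icc (0 : ℝ) 1,
          c ≤ |φ₃₃ s * φ₄₄ t - φ₄₃ s * φ₃₄ t|) →
        ∀ M : ℕ, 1 ≤ M → ∀ a b a' b' : ℕ, a ≤ b → b < a' → a' ≤ b' → b' ≤ M →
          (M : ℝ) ≤ 4 * ((a' : ℝ) - b) → ∀ c₀ c₀' : ℝ,
          (∫ y in Set.Icc ![0, 0, c₀, c₀'] ![1, 1, c₀ + (M : ℝ) ^ 2, c₀' + M],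
            ‖∑ m ∈ Finset.Icc a b, Complex.exp (2 * ↑π * I *
                ↑((m : ℝ) * y 0 + (m : ℝ) ^ 2 * y 1 + φ₃ ((m : ℝ) / M) * y 2 + φ₄ ((m : ℝ) / M) * y 3))‖ ^ 6 *
              ‖∑ m ∈ Finset.Icc a' b', Complex.exp (2 * ↑π * I *
                ↑((m : ℝ) * y 0 + (m : ℝ) ^ 2 * y 1 + φ₃ ((m : ℝ) / M) * y 2 + φ₄ ((m : ℝ) / M) * y 3))‖ ^ 6) ≤
            C * (M : ℝ) ^ (9 + ε)) :
    ∀ ε : ℝ, 0 < ε → ∃ C : ℝ, ∀ N : ℕ, 1 ≤ N → ∀ N₀ M : ℕ,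
      100 * M < N₀ → N₀ + M ≤ N → ∀ a b a' b' : ℕ,
        N₀ ≤ a → a ≤ b → b < a' → a' ≤ b' → b' ≤ N₀ + M → (M : ℝ) ≤ 4 * ((a' : ℝ) - b) →
          (∫ x in bourgainA6Box,
            ‖∑ n ∈ Finset.Icc a b,
                Complex.exp (2 * ↑π * I * ↑(bourgainA6Phase N (1 / (N : ℝ) ^ 2) (1 / N) x n))‖ ^ 6 *
              ‖∑ n ∈ Finset.Icc a' b',
                Complex.exp (2 * ↑π * I * ↑(bourgainA6Phase N (1 / (N : ℝ) ^ 2) (1 / N) x n))‖ ^ 6) ≤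
            C * (N : ℝ) ^ (4 + ε) * (M : ℝ) ^ 2 :=
  Bourgain2017_eq223_of_eq222 (Bourgain2017_eq222_of_eq210 h210)

/-- **Bourgain 2017, Theorem 2 (2.12) from the general decoupling bound (2.10)** (composition with
`Literature.NumberTheory.LFunctions.Bourgain2017_theorem2_of_eq223`).
[cite: BourgainJAMS2017, Theorem 2, eq. (2.12); §3] -/
theorem Bourgain2017_theorem2_of_eq210
    (h210 : ∀ ε c B : ℝ, 0 < ε → 0 < c → ∃ C : ℝ,
      ∀ (φ₃ φ₃₁ φ₃₂ φ₃₃ φ₃₄ φ₃₅ φ₄ φ₄₁ φ₄₂ φ₄₃ φ₄₄ φ₄₅ : ℝ → ℝ),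
        (∀ t ∈ Set.Icc (0 : ℝ) 1,
          HasDerivAt φ₃ (φ₃₁ t) t ∧ HasDerivAt φ₃₁ (φ₃₂ t) t ∧ HasDerivAt φ₃₂ (φ₃₃ t) t ∧
            HasDerivAt φ₃₃ (φ₃₄ t) t ∧ HasDerivAt φ₃₄ (φ₃₅ t) t ∧
          HasDerivAt φ₄ (φ₄₁ t) t ∧ HasDerivAt φ₄₁ (φ₄₂ t) t ∧ HasDerivAt φ₄₂ (φ₄₃ t) t ∧
            HasDerivAt φ₄₃ (φ₄₄ t) t ∧ HasDerivAt φ₄₄ (φ₄₅ t) t) →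
        (∀ t ∈ Set.Icc (0 : ℝ) 1,
          |φ₃ t| ≤ B ∧ |φ₃₁ t| ≤ B ∧ |φ₃₂ t| ≤ B ∧ |φ₃₃ t| ≤ B ∧ |φ₃₄ t| ≤ B ∧ |φ₃₅ t| ≤ B ∧
          |φ₄ t| ≤ B ∧ |φ₄₁ t| ≤ B ∧ |φ₄₂ t| ≤ B ∧ |φ₄₃ t| ≤ B ∧ |φ₄₄ t| ≤ B ∧ |φ₄₅ t| ≤ B) →
        (∀ t ∈ Set.Icc (0 : ℝ) 1, c ≤ |φ₃₃ t|) →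
        (∀ s ∈ Set.Icc (0 : ℝ) 1, ∀ t ∈ Set.Icc (0 : ℝ) 1,
          c ≤ |φ₃₃ s * φ₄₄ t - φ₄₃ s * φ₃₄ t|) →
        ∀ M : ℕ, 1 ≤ M → ∀ a b a' b' : ℕ, a ≤ b → b < a' → a' ≤ b' → b' ≤ M →
          (M : ℝ) ≤ 4 * ((a' : ℝ) - b) → ∀ c₀ c₀' : ℝ,
          (∫ y in Set.Icc ![0, 0, c₀, c₀'] ![1, 1, c₀ + (M : ℝ) ^ 2, c₀' + M],
            ‖∑ m ∈ Finset.Icc a b, Complex.exp (2 * ↑π * I *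
                ↑((m : ℝ) * y 0 + (m : ℝ) ^ 2 * y 1 + φ₃ ((m : ℝ) / M) * y 2 + φ₄ ((m : ℝ) / M) * y 3))‖ ^ 6 *
              ‖∑ m ∈ Finset.Icc a' b', Complex.exp (2 * ↑π * I *
                ↑((m : ℝ) * y 0 + (m : ℝ) ^ 2 * y 1 + φ₃ ((m : ℝ) / M) * y 2 + φ₄ ((m : ℝ) / M) * y 3))‖ ^ 6) ≤
            C * (M : ℝ) ^ (9 + ε)) :
    ∀ ε : ℝ, 0 < ε → ∃ C : ℝ, ∀ N : ℕ, 1 ≤ N →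
      bourgainA6 N (1 / (N : ℝ) ^ 2) (1 / N) ≤ C * (N : ℝ) ^ (6 + ε) :=
  Bourgain2017_theorem2_of_eq223 (Bourgain2017_eq223_of_eq210 h210)

/-- **Bourgain 2017, Corollary 3 (2.28) from the general decoupling bound (2.10)**: the composition
of everything proved about §3 in this tree ((2.13)–(2.27) and the rescaling). The conclusion is
literally the hypothesis `hC3` of
`Literature.NumberTheory.LFunctions.Bourgain2017_theorem4_log_of_reduction`; after this file the part
of Corollary 3 that remains an assumption in the discharge of
`Literature.NumberTheory.LFunctions.Bourgain2017_theorem4_log` is exactly `h210`, the decoupling bound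
(2.10) for the curves `(t, t², φ₃, φ₄)` satisfying (2.11) — Theorem 1 of the paper (`d = 4`) plus two
Bourgain–Demeter `L⁶` decouplings and the discrete `L⁶` restriction for the parabola, eqs.
(2.1)–(2.10). [cite: BourgainJAMS2017, Corollary 3, eq. (2.28); Theorem 1; §3] -/
theorem Bourgain2017_corollary3_of_eq210
    (h210 : ∀ ε c B : ℝ, 0 < ε → 0 < c → ∃ C : ℝ,
      ∀ (φ₃ φ₃₁ φ₃₂ φ₃₃ φ₃₄ φ₃₅ φ₄ φ₄₁ φ₄₂ φ₄₃ φ₄₄ φ₄₅ : ℝ → ℝ),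
        (∀ t ∈ Set.Icc (0 : ℝ) 1,
          HasDerivAt φ₃ (φ₃₁ t) t ∧ HasDerivAt φ₃₁ (φ₃₂ t) t ∧ HasDerivAt φ₃₂ (φ₃₃ t) t ∧
            HasDerivAt φ₃₃ (φ₃₄ t) t ∧ HasDerivAt φ₃₄ (φ₃₅ t) t ∧
          HasDerivAt φ₄ (φ₄₁ t) t ∧ HasDerivAt φ₄₁ (φ₄₂ t) t ∧ HasDerivAt φ₄₂ (φ₄₃ t) t ∧
            HasDerivAt φ₄₃ (φ₄₄ t) t ∧ HasDerivAt φ₄₄ (φ₄₅ t) t) →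
        (∀ t ∈ Set.Icc (0 : ℝ) 1,
          |φ₃ t| ≤ B ∧ |φ₃₁ t| ≤ B ∧ |φ₃₂ t| ≤ B ∧ |φ₃₃ t| ≤ B ∧ |φ₃₄ t| ≤ B ∧ |φ₃₅ t| ≤ B ∧
          |φ₄ t| ≤ B ∧ |φ₄₁ t| ≤ B ∧ |φ₄₂ t| ≤ B ∧ |φ₄₃ t| ≤ B ∧ |φ₄₄ t| ≤ B ∧ |φ₄₅ t| ≤ B) →
        (∀ t ∈ Set.Icc (0 : ℝ) 1, c ≤ |φ₃₃ t|) →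
        (∀ s ∈ Set.Icc (0 : ℝ) 1, ∀ t ∈ Set.Icc (0 : ℝ) 1,
          c ≤ |φ₃₃ s * φ₄₄ t - φ₄₃ s * φ₃₄ t|) →
        ∀ M : ℕ, 1 ≤ M → ∀ a b a' b' : ℕ, a ≤ b → b < a' → a' ≤ b' → b' ≤ M →
          (M : ℝ) ≤ 4 * ((a' : ℝ) - b) → ∀ c₀ c₀' : ℝ,
          (∫ y in Set.Icc ![0, 0, c₀, c₀'] ![1, 1, c₀ + (M : ℝ) ^ 2, c₀' + M],
            ‖∑ m ∈ Finset.Icc a b, Complex.exp (2 * ↑π * I *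
                ↑((m : ℝ) * y 0 + (m : ℝ) ^ 2 * y 1 + φ₃ ((m : ℝ) / M) * y 2 + φ₄ ((m : ℝ) / M) * y 3))‖ ^ 6 *
              ‖∑ m ∈ Finset.Icc a' b', Complex.exp (2 * ↑π * I *
                ↑((m : ℝ) * y 0 + (m : ℝ) ^ 2 * y 1 + φ₃ ((m : ℝ) / M) * y 2 + φ₄ ((m : ℝ) / M) * y 3))‖ ^ 6) ≤
            C * (M : ℝ) ^ (9 + ε)) :
    ∀ ε : ℝ, 0 < ε → ∃ C : ℝ, ∀ N : ℕ, 1 ≤ N → ∀ δ Δ : ℝ,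
      1 / (N : ℝ) ^ 2 ≤ δ → δ ≤ 1 → 1 / (N : ℝ) ≤ Δ → Δ ≤ 1 →
        bourgainA6 N δ Δ ≤ C * δ * Δ * (N : ℝ) ^ (9 + ε) :=
  Bourgain2017_corollary3_of_theorem2 (Bourgain2017_theorem2_of_eq210 h210)

end Literature.NumberTheory.LFunctions
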